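import Mathlib
import Literature.Combinatorics.SetFamily.CubeEdgeIsoperimetry
import HarnessLib

/-!
# Ellis' stability theorem for the edge-isoperimetric inequality in the cube (proved):
# discharge of `CubeEdgeIsoperimetry.Ellis2011_thm`

Source followed (held, read in full): D. Ellis, *Almost isoperimetric subsets of the discrete cube*,
Combin. Probab. Comput. 20 (2011) 363–380 [Ellis2011] (held text `paper:arxiv-1310.8179`; `pNNNN` =
chunk of the held text), §2 "Main results": Lemma 5 (the splitting inequality with the binary entropy,
eq. (3)–(4), p0006), Lemma 6 ("case 1 must occur for some coordinate", p0006–p0007), Theorem 7 (rough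
stability, p0007–p0008), Theorems 8–9 (the counting bound (eq. tightbound) and exact stability for sets
of size `2^t`, p0008–p0009) and Corollary 10 (p0009) — the statement restated as
[EllisKellerLifshitz2018, Thm 1.4] and typed in `CubeEdgeIsoperimetry.lean` as the named fact
`Ellis2011_thm`, which is DISCHARGED here (`Ellis2011_thm_holds`, last section).

ARCHITECTURE (mirrors [Ellis2011, §2]; all on a finite ground set `X`, families `𝓕 ⊆ P(X)`, the
tree's `edgeBoundaryIn X 𝓕 = |∂𝓕|`):
* §1 directional boundary `∂_i 𝓕` (`dirBoundary`), `|∂𝓕| = Σ_i |∂_i 𝓕|`; the lower/upper `a`-sections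
  `𝓕_a^−, 𝓕_a^+` [Ellis2011, §1 p0002] (`lowerSection`, `upperSection`); `|∂_a 𝓕| = |𝓕_a^+ Δ 𝓕_a^−|`.
* §2 the isoperimetric EXCESS `exc_X(𝓕) = |∂𝓕| − |𝓕| log₂(2^{|X|}/|𝓕|) ≥ 0` (Ellis' `ε₀|A|`; the tree's
  `card_mul_sub_logb_le_edgeBoundaryIn`) and Ellis' identity (3):
  `exc(𝓕) = exc(𝓕₀) + exc(𝓕₁) + Φ(|𝓕₀|,|𝓕₁|) − |𝓕| + |∂_a 𝓕|`, `Φ(x,y) = (x+y)log₂(x+y) − x log₂ x − y log₂ y`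
  (`= |𝓕|·H₂(γ)`).
* §3 the entropy calculus of Lemma 5: with `s = min, ℓ = max` of the section sizes,
  `Φ ≥ 2s + (3/2)s` when `ℓ ≥ 4s` and `Φ ≥ 2s + (ℓ − s)/4` when `s ≤ ℓ ≤ 4s`. DEVIATION: Ellis uses the
  concavity of `F(γ) = H₂(γ) − 2γ` with the sharp constants `5(log₂5 − 2)` and `10/3`; we use the
  monotonicity of `u ↦ (u+1)ln(u+1) − u ln u` (tree) and of `u ↦ (u+1)ln(u+1) − u ln u − u ln(5/4)` on
  `[1,4]`, with the cruder constants `3/2`, `1/4` — every constant of the theorem is existential.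
* §4 bridges: `|∂(P(X) ∖ 𝓕)| = |∂𝓕|`; translation of a family inside a subcube; the KKL
  edge-isoperimetric inequality for a family on a ground set `X` (from the tree's proved
  `Literature.Computability.Complexity.LowDegree.KKL.kkl_edge_isoperimetric`, O'Donnell §9.6, via
  `X ≃ Fin |X|` and `pmIndicator`). DEVIATION: Ellis invokes Talagrand's inequality
  `Σ β_i/log₂(1/β_i) ≥ K p(1−p)` [Ellis2011, Thm 4]; the KKL edge-isoperimetric form
  `3 Var 3^{−I/Var} ≤ √(max_i β_i) · I` gives the same conclusion ("if all influences are small the edge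
  boundary is large") and is what the tree has.
* §5 Lemma 6 [Ellis2011, p0006]: `exc ≤ ε|𝓕|`, `|𝓕| ≤ (1−ε)2^{|X|}`, `0 < ε ≤ c₆` ⇒ some coordinate has a
  section of size `≤ (2/3)ε|𝓕|` ("case 1"), by strong induction on `X` (measure `≤ 1/2`: descent to a
  section; `(1/2, 7/8]`: KKL; `> 7/8`: complement), `c₆ = 10⁻⁷`.
* §6 Theorem 7 [Ellis2011, p0007]: rough stability — a subcube `S` with `(3/2)|𝓕 ∖ S| ≤ exc(𝓕)` and
  `|𝓕 ∩ S| > (1−ε)|S|`. DEVIATION: Ellis telescopes the RATIOS `ε^{(k)}` with products `Π(1−γ^{(j)})`;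
  the absolute excess telescopes linearly (`exc(𝓕) ≥ exc(𝓕_large) + (3/2)|𝓕_small|`), same content.
* §7 the counting bound [Ellis2011, proof of Thm 8, display (tightbound), p0008]:
  `|∂𝓕| ≥ N|𝓕 ∩ S| − |D| + |∂_S M| + |∂D| − |D|` (`M = S ∖ 𝓕`, `D = 𝓕 ∖ S`, `N` = codimension), hence for
  `|S| = |𝓕| = 2^d`: `exc(𝓕) ≥ 2^d δ* log₂(1/δ*)`, `δ* = |𝓕 Δ S|/2^d` [Ellis2011, proof of Thm 9].
* §8 `x ↦ x log₂(1/x)` is monotone on `[0, 1/e]` [Ellis2011, proof of Thm 9] and `≤ 3√x`.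
* §9 assembly of Corollary 10 = [EllisKellerLifshitz2018, Thm 1.4]: `Ellis2011_thm_holds`, absolute
  constant `c = (c₆/3)²` (`c₆ = 10⁻⁷`; Ellis' constants are not optimised either).

* appended (v2): Theorem 7 AS PRINTED for families of arbitrary size (`rough_stability_symmDiff`,
  `ellis_rough_stability`: `|𝓕 Δ C| < 3ε|𝓕|`) and Theorem 9 in contrapositive form
  (`exists_subcube_of_edgeBoundary_lt`).

The whole file elaborates within `maxHeartbeats 100000` (checked 2026-08-28).

Nothing here is specific to P versus NP; this is analysis of Boolean functions (support/instrument).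

## References
* [Ellis2011] D. Ellis, *Almost isoperimetric subsets of the discrete cube*, CPC 20 (2011) 363–380, §2.
* [EllisKellerLifshitz2018] D. Ellis, N. Keller, N. Lifshitz, *On the structure of subsets of the discrete
  cube with small edge boundary*, Discrete Analysis 2018:9, Thm 1.4.
* [ODonnell2014] R. O'Donnell, *Analysis of Boolean Functions*, CUP 2014, §9.6 (KKL edge-isoperimetric).
-/

noncomputable section

open Finset

open scoped BigOperators symmDiff

namespace Literature.Combinatorics.SetFamily

namespace CubeEdgeIsoperimetry

/-! ### §1 Directional boundary, sections -/

section General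

variable {α : Type*} [DecidableEq α]

/-- **`|∂_i 𝓕|`, the number of boundary edges in direction `i`**: members `S ∈ 𝓕` with `S Δ {i} ∉ 𝓕`
("`∂_i A = |A_i^+ Δ A_i^−|` for the number of edges of the boundary of `A` in direction `i`").
[cite: Ellis2011, §1 (p0002, display defining ∂_i A)] -/
def dirBoundary (i : α) (𝓕 : Finset (Finset α)) : ℕ := (𝓕.filter fun S => S ∆ {i} ∉ 𝓕).card

/-- `|∂𝓕| = Σ_{i ∈ X} |∂_i 𝓕|` ("clearly `Σ_i β_i = |∂A|/2^{n−1}`"). [cite: Ellis2011, §1 (p0002)] -/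
theorem edgeBoundaryIn_eq_sum_dirBoundary (X : Finset α) (𝓕 : Finset (Finset α)) :
    edgeBoundaryIn X 𝓕 = ∑ i ∈ X, dirBoundary i 𝓕 := by
  unfold edgeBoundaryIn dirBoundary
  rw [card_filter, sum_product_right]
  refine sum_congr rfl fun i _ => ?_
  rw [card_filter]

/-- **The lower `a`-section** `𝓕_a^− = {S ∈ 𝓕 : a ∉ S}` (a family on the ground set without `a`).
[cite: Ellis2011, §1 (p0002, display defining A_i^−)] -/
def lowerSection (a : α) (𝓕 : Finset (Finset α)) : Finset (Finset α) := 𝓕.filter fun S => a ∉ S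

/-- **The upper `a`-section** `𝓕_a^+ = {S ∖ {a} : S ∈ 𝓕, a ∈ S}`.
[cite: Ellis2011, §1 (p0002, display defining A_i^+)] -/
def upperSection (a : α) (𝓕 : Finset (Finset α)) : Finset (Finset α) :=
  (𝓕.filter fun S => a ∈ S).image fun S => S.erase a

/-- Membership in the lower section. [cite: Ellis2011, §1 (p0002)] -/
theorem mem_lowerSection {a : α} {𝓕 : Finset (Finset α)} {S : Finset α} :
    S ∈ lowerSection a 𝓕 ↔ S ∈ 𝓕 ∧ a ∉ S := by
  rw [lowerSection, mem_filter]

/-- Membership in the upper section: `T ∈ 𝓕_a^+ ↔ a ∉ T ∧ T ∪ {a} ∈ 𝓕`. [cite: Ellis2011, §1 (p0002)] -/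
theorem mem_upperSection {a : α} {𝓕 : Finset (Finset α)} {T : Finset α} :
    T ∈ upperSection a 𝓕 ↔ a ∉ T ∧ insert a T ∈ 𝓕 := by
  rw [upperSection, mem_image]
  constructor
  · rintro ⟨S, hS, rfl⟩
    rw [mem_filter] at hS
    exact ⟨notMem_erase a S, by rw [insert_erase hS.2]; exact hS.1⟩
  · rintro ⟨haT, hT⟩
    exact ⟨insert a T, mem_filter.2 ⟨hT, mem_insert_self a T⟩, erase_insert haT⟩

/-- `S ↦ S ∖ {a}` is injective on the members containing `a`. [cite: Ellis2011, §1 (p0002)] -/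
theorem erase_injOn (a : α) (𝓕 : Finset (Finset α)) :
    Set.InjOn (fun S : Finset α => S.erase a) ↑(𝓕.filter fun S => a ∈ S) := fun S hS T hT hST => by
  have haS : a ∈ S := (mem_filter.1 (mem_coe.1 hS)).2
  have haT : a ∈ T := (mem_filter.1 (mem_coe.1 hT)).2
  simpa [insert_erase haS, insert_erase haT] using congrArg (insert a) hST

/-- `|𝓕_a^+| = |{S ∈ 𝓕 : a ∈ S}|`. [cite: Ellis2011, §1 (p0002)] -/
theorem card_upperSection (a : α) (𝓕 : Finset (Finset α)) :
    (upperSection a 𝓕).card = (𝓕.filter fun S => a ∈ S).card := by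
  rw [upperSection]
  exact card_image_of_injOn (erase_injOn a 𝓕)

/-- `|𝓕_a^−| + |𝓕_a^+| = |𝓕|`. [cite: Ellis2011, §1 (p0002)] -/
theorem card_lowerSection_add_card_upperSection (a : α) (𝓕 : Finset (Finset α)) :
    (lowerSection a 𝓕).card + (upperSection a 𝓕).card = 𝓕.card := by
  rw [card_upperSection, lowerSection, add_comm]
  exact card_filter_add_card_filter_not _

/-- The lower section of a family on `X ∪ {a}` lives on `X`. [cite: Ellis2011, §1 (p0002)] -/
theorem subset_of_mem_lowerSection {X : Finset α} {a : α} {𝓕 : Finset (Finset α)}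
    (h𝓕 : ∀ S ∈ 𝓕, S ⊆ insert a X) : ∀ S ∈ lowerSection a 𝓕, S ⊆ X := fun S hS => by
  rw [mem_lowerSection] at hS
  exact (subset_insert_iff_of_notMem hS.2).1 (h𝓕 S hS.1)

/-- The upper section of a family on `X ∪ {a}` lives on `X`. [cite: Ellis2011, §1 (p0002)] -/
theorem subset_of_mem_upperSection {X : Finset α} {a : α} {𝓕 : Finset (Finset α)}
    (h𝓕 : ∀ S ∈ 𝓕, S ⊆ insert a X) : ∀ S ∈ upperSection a 𝓕, S ⊆ X := fun S hS => by
  rw [mem_upperSection] at hS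
  intro x hx
  have hx' : x ∈ insert a X := h𝓕 _ hS.2 (mem_insert_of_mem hx)
  exact mem_of_mem_insert_of_ne hx' (fun h => hS.1 (h ▸ hx))

/-- The exact splitting identity of the tree in section notation:
`|∂_{X∪{a}} 𝓕| = |∂_X 𝓕_a^−| + |∂_X 𝓕_a^+| + (|𝓕_a^− ∖ 𝓕_a^+| + |𝓕_a^+ ∖ 𝓕_a^−|)`.
[cite: Ellis2011, §2 (p0006, first display of the proof of Lemma 5)] -/
theorem edgeBoundaryIn_insert_sections {X : Finset α} {a : α} (ha : a ∉ X) (𝓕 : Finset (Finset α)) :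
    edgeBoundaryIn (insert a X) 𝓕 =
      edgeBoundaryIn X (lowerSection a 𝓕) + edgeBoundaryIn X (upperSection a 𝓕) +
        ((lowerSection a 𝓕 \ upperSection a 𝓕).card + (upperSection a 𝓕 \ lowerSection a 𝓕).card) := by
  rw [edgeBoundaryIn_insert_eq ha 𝓕, add_assoc]
  rfl

/-- The boundary on the empty ground set is empty. [cite: Ellis2011, §1 (p0002)] -/
theorem edgeBoundaryIn_empty (𝓕 : Finset (Finset α)) : edgeBoundaryIn ∅ 𝓕 = 0 := by
  simp [edgeBoundaryIn]

/-- **`|∂_a 𝓕| = |𝓕_a^+ Δ 𝓕_a^−|`** = `|𝓕_a^− ∖ 𝓕_a^+| + |𝓕_a^+ ∖ 𝓕_a^−|`.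
[cite: Ellis2011, §1 (p0002, "∂_i A = |A_i^+ Δ A_i^-|")] -/
theorem dirBoundary_eq_card_sdiff_add (a : α) (𝓕 : Finset (Finset α)) :
    dirBoundary a 𝓕 =
      (lowerSection a 𝓕 \ upperSection a 𝓕).card + (upperSection a 𝓕 \ lowerSection a 𝓕).card := by
  have h := edgeBoundaryIn_insert_sections (X := (∅ : Finset α)) (Finset.notMem_empty a) 𝓕
  rw [edgeBoundaryIn_empty, edgeBoundaryIn_empty, zero_add, zero_add, Finset.insert_empty,
    edgeBoundaryIn_eq_sum_dirBoundary, sum_singleton] at h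
  exact h

/-- `a ∈ S Δ {j} ↔ a ∈ S` for `j ≠ a`. [cite: Ellis2011, §1 (p0002)] -/
theorem mem_symmDiff_singleton_iff_of_ne {S : Finset α} {a j : α} (hja : j ≠ a) :
    a ∈ S ∆ ({j} : Finset α) ↔ a ∈ S := by
  rw [mem_symmDiff, mem_singleton]
  constructor
  · rintro (⟨h, -⟩ | ⟨h, -⟩)
    · exact h
    · exact absurd h hja.symm
  · intro h
    exact Or.inl ⟨h, hja.symm⟩

/-- `(S ∖ {a}) Δ {j} = (S Δ {j}) ∖ {a}` for `j ≠ a`. [cite: Ellis2011, §1 (p0002)] -/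
theorem erase_symmDiff_singleton {S : Finset α} {a j : α} (hja : j ≠ a) :
    (S.erase a) ∆ ({j} : Finset α) = (S ∆ {j}).erase a := by
  ext x
  simp only [mem_symmDiff, mem_erase, mem_singleton]
  by_cases hxa : x = a
  · subst hxa
    simp [hja.symm]
  · simp [hxa]

/-- `(T ∪ {a}) Δ {j} = (T Δ {j}) ∪ {a}` for `j ≠ a`. [cite: Ellis2011, §1 (p0002)] -/
theorem insert_symmDiff_singleton' {T : Finset α} {a j : α} (hja : j ≠ a) :
    (insert a T) ∆ ({j} : Finset α) = insert a (T ∆ {j}) := by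
  ext x
  simp only [mem_symmDiff, mem_insert, mem_singleton]
  by_cases hxa : x = a
  · subst hxa
    simp [hja.symm]
  · simp [hxa]

/-- **Boundary edges in a direction `j ≠ a` split over the two `a`-sections**:
`|∂_j 𝓕| = |∂_j 𝓕_a^−| + |∂_j 𝓕_a^+|`. [cite: Ellis2011, §2 (p0007, "β_j' … and therefore β_j ≥ …": influences of a section are bounded by those of the set)] -/
theorem dirBoundary_eq_add_of_ne {a j : α} (hja : j ≠ a) (𝓕 : Finset (Finset α)) :
    dirBoundary j 𝓕 = dirBoundary j (lowerSection a 𝓕) + dirBoundary j (upperSection a 𝓕) := by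
  classical
  unfold dirBoundary
  rw [card_filter, card_filter, card_filter,
    ← sum_filter_add_sum_filter_not 𝓕 (fun S => a ∈ S), add_comm]
  congr 1
  · rw [lowerSection]
    refine sum_congr rfl fun S hS => ?_
    have haS : a ∉ S := (mem_filter.1 hS).2
    have hiff : S ∆ {j} ∉ 𝓕 ↔ S ∆ {j} ∉ 𝓕.filter (fun S => a ∉ S) := by
      rw [mem_filter]
      constructor
      · exact fun h h' => h h'.1
      · exact fun h h' => h ⟨h', fun h'' => haS ((mem_symmDiff_singleton_iff_of_ne hja).1 h'')⟩
    simp only [hiff]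
  · rw [upperSection, sum_image (erase_injOn a 𝓕)]
    refine sum_congr rfl fun S hS => ?_
    have haS : a ∈ S := (mem_filter.1 hS).2
    have hiff : S ∆ {j} ∉ 𝓕 ↔
        (S.erase a) ∆ {j} ∉ (𝓕.filter fun S => a ∈ S).image (fun S => S.erase a) := by
      have hmem : (S.erase a) ∆ {j} ∈ (𝓕.filter fun S => a ∈ S).image (fun S => S.erase a) ↔
          S ∆ {j} ∈ 𝓕 := by
        have h1 : (S.erase a) ∆ ({j} : Finset α) ∈ upperSection a 𝓕 ↔ S ∆ {j} ∈ 𝓕 := by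
          rw [mem_upperSection, erase_symmDiff_singleton hja,
            insert_erase ((mem_symmDiff_singleton_iff_of_ne hja).2 haS)]
          exact ⟨fun h => h.2, fun h => ⟨notMem_erase _ _, h⟩⟩
        exact h1
      rw [hmem]
    simp only [hiff]

/-! ### §2 The isoperimetric excess and Ellis' splitting identity (3) -/

/-- **The isoperimetric excess** `exc_X(𝓕) = |∂_X 𝓕| − |𝓕|(|X| − log₂|𝓕|) = |∂𝓕| − |𝓕| log₂(2^{|X|}/|𝓕|)`
(Ellis writes `|∂A| = |A|(log₂(2ⁿ/|A|) + ε₀)`, so `exc = ε₀|A|`). [cite: Ellis2011, §2 (p0006, Lemma 5, display (almostiso))] -/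
def excess (X : Finset α) (𝓕 : Finset (Finset α)) : ℝ :=
  (edgeBoundaryIn X 𝓕 : ℝ) - 𝓕.card * ((X.card : ℝ) - Real.logb 2 𝓕.card)

/-- The excess is nonnegative (the edge-isoperimetric inequality, logarithmic form, proved in the tree).
[cite: Ellis2011, §1 (p0001, display (1))] -/
theorem excess_nonneg {X : Finset α} {𝓕 : Finset (Finset α)} (h𝓕 : ∀ S ∈ 𝓕, S ⊆ X) :
    0 ≤ excess X 𝓕 := by
  have := card_mul_sub_logb_le_edgeBoundaryIn X 𝓕 h𝓕
  unfold excess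
  linarith

/-- **`Φ(x,y) = (x+y) log₂(x+y) − x log₂ x − y log₂ y`** (`= (x+y) H₂(x/(x+y))`, the binary-entropy term
of Lemma 5). [cite: Ellis2011, §2 (p0006, display (3): the term (H₂(γ) − …)|A|)] -/
def entropyGain (x y : ℝ) : ℝ :=
  (x + y) * Real.logb 2 (x + y) - x * Real.logb 2 x - y * Real.logb 2 y

/-- `Φ` is symmetric. [cite: Ellis2011, §2 (p0006)] -/
theorem entropyGain_comm (x y : ℝ) : entropyGain x y = entropyGain y x := by
  unfold entropyGain
  rw [add_comm y x]
  ring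

/-- `Φ(x,y) ≥ 2 min(x,y)` (the tree's two-point inequality; `H₂(γ) ≥ 2γ` for `γ ≤ 1/2`).
[cite: Ellis2011, §2 (p0006, "F(γ) = H₂(γ) − 2γ … concave … F ≥ 0")] -/
theorem two_mul_min_le_entropyGain {x y : ℝ} (hx : 0 ≤ x) (hy : 0 ≤ y) :
    2 * min x y ≤ entropyGain x y :=
  two_mul_min_le_entropy hx hy

/-- **Ellis' identity (3)**: for `a ∉ X` and a family `𝓕` on `X ∪ {a}` with sections `𝓕₀ = 𝓕_a^−`,
`𝓕₁ = 𝓕_a^+`: `exc(𝓕) = exc(𝓕₀) + exc(𝓕₁) + Φ(|𝓕₀|,|𝓕₁|) − |𝓕| + |∂_a 𝓕|`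
("`|∂A| = |A| log₂(2ⁿ/|A|) − (1 − H₂(γ))|A| + ε⁺|A_i^+| + ε^−|A_i^−| + |A_i^+ Δ A_i^−|`").
[cite: Ellis2011, §2 (p0006, display (3))] -/
theorem excess_insert {X : Finset α} {a : α} (ha : a ∉ X) (𝓕 : Finset (Finset α)) :
    excess (insert a X) 𝓕 =
      excess X (lowerSection a 𝓕) + excess X (upperSection a 𝓕) +
        entropyGain ((lowerSection a 𝓕).card : ℝ) ((upperSection a 𝓕).card : ℝ) - 𝓕.card +
        dirBoundary a 𝓕 := by
  unfold excess entropyGain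
  rw [edgeBoundaryIn_insert_sections ha, dirBoundary_eq_card_sdiff_add, card_insert_of_notMem ha]
  have hm : (𝓕.card : ℝ) = (lowerSection a 𝓕).card + (upperSection a 𝓕).card := by
    exact_mod_cast (card_lowerSection_add_card_upperSection a 𝓕).symm
  rw [hm]
  push_cast
  ring

/-- **Lemma 5, the inequality form (4)**: `exc(𝓕) ≥ exc(𝓕₀) + exc(𝓕₁) + (Φ(|𝓕₀|,|𝓕₁|) − 2 min(|𝓕₀|,|𝓕₁|))`
(`|∂_a 𝓕| ≥ ||𝓕₀| − |𝓕₁||`; the last bracket is Ellis' `F(γ)|A| ≥ 0`).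
[cite: Ellis2011, §2 (p0006, display (4))] -/
theorem excess_sections_le {X : Finset α} {a : α} (ha : a ∉ X) (𝓕 : Finset (Finset α)) :
    excess X (lowerSection a 𝓕) + excess X (upperSection a 𝓕) +
        (entropyGain ((lowerSection a 𝓕).card : ℝ) ((upperSection a 𝓕).card : ℝ) -
          2 * min ((lowerSection a 𝓕).card : ℝ) ((upperSection a 𝓕).card : ℝ)) ≤
      excess (insert a X) 𝓕 := by
  rw [excess_insert ha]
  have hd0 : ((lowerSection a 𝓕).card : ℝ) ≤
      (lowerSection a 𝓕 \ upperSection a 𝓕).card + (upperSection a 𝓕).card := by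
    exact_mod_cast card_le_card_sdiff_add_card
  have hd1 : ((upperSection a 𝓕).card : ℝ) ≤
      (upperSection a 𝓕 \ lowerSection a 𝓕).card + (lowerSection a 𝓕).card := by
    exact_mod_cast card_le_card_sdiff_add_card
  have hD : (dirBoundary a 𝓕 : ℝ) =
      (lowerSection a 𝓕 \ upperSection a 𝓕).card + (upperSection a 𝓕 \ lowerSection a 𝓕).card := by
    exact_mod_cast dirBoundary_eq_card_sdiff_add a 𝓕
  have hm : (𝓕.card : ℝ) = (lowerSection a 𝓕).card + (upperSection a 𝓕).card := by
    exact_mod_cast (card_lowerSection_add_card_upperSection a 𝓕).symm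
  rcases le_total ((lowerSection a 𝓕).card : ℝ) ((upperSection a 𝓕).card : ℝ) with h | h
  · rw [min_eq_left h]; linarith
  · rw [min_eq_right h]; linarith

/-! ### §3 The entropy calculus of Lemma 5 -/

/-- Numeric input `2^{23} ≤ 5^{10}`: `(7/2) ln 2 ≤ 5 ln 5 − 8 ln 2` (i.e. `5 log₂ 5 − 8 ≥ 7/2`; Ellis'
slope is `5(log₂ 5 − 2) ≈ 1.61 ≥ 3/2`). [cite: Ellis2011, §2 (p0006, "F(γ) ≥ 5(log₂5 − 2)γ")] -/
theorem seven_halves_log_two_le : (7 / 2 : ℝ) * Real.log 2 ≤ 5 * Real.log 5 - 8 * Real.log 2 := by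
  have h : Real.log ((2 : ℝ) ^ 23) ≤ Real.log ((5 : ℝ) ^ 10) :=
    Real.log_le_log (by positivity) (by norm_num)
  rw [Real.log_pow, Real.log_pow] at h
  push_cast at h
  linarith

/-- **Case 1 slope** (`γ ≤ 1/5`): for `0 ≤ y`, `4y ≤ x`: `Φ(x,y) ≥ 2y + (3/2)y` — from the monotonicity
of `u ↦ (u+1)ln(u+1) − u ln u` on `[1,∞)` at `u = x/y ≥ 4` (Ellis: `F(γ) ≥ 5(log₂5 − 2)γ` for
`γ ≤ 1/5`, by concavity; our constant `3/2 ≤ 5(log₂ 5 − 2)`). [cite: Ellis2011, §2 (p0006, "for γ ≤ 1/5, F(γ) ≥ 5(log₂5−2)γ")] -/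
theorem entropyGain_ge_of_four_mul_le {x y : ℝ} (hy : 0 ≤ y) (h4 : 4 * y ≤ x) :
    2 * y + 3 / 2 * y ≤ entropyGain x y := by
  rcases hy.eq_or_lt with rfl | hy0
  · simp [entropyGain]
  have hx0 : 0 < x := by linarith
  have hu4 : (4 : ℝ) ≤ x / y := by rw [le_div_iff₀ hy0]; linarith
  have hmono := monotoneOn_succ_mul_log_sub_mul_log (Set.mem_Ici.2 (by norm_num : (1 : ℝ) ≤ 4))
    (Set.mem_Ici.2 (le_trans (by norm_num) hu4)) hu4
  have hlog4 : Real.log 4 = 2 * Real.log 2 := by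
    rw [show (4 : ℝ) = 2 ^ 2 by norm_num, Real.log_pow]; norm_num
  have h5 : (4 : ℝ) + 1 = 5 := by norm_num
  simp only [h5, hlog4] at hmono
  have hxy : x / y + 1 = (x + y) / y := by field_simp
  rw [hxy, Real.log_div (by linarith) hy0.ne', Real.log_div hx0.ne' hy0.ne'] at hmono
  have := mul_le_mul_of_nonneg_left hmono hy
  have hy' : y * ((x + y) / y * (Real.log (x + y) - Real.log y) - x / y * (Real.log x - Real.log y)) =
      (x + y) * Real.log (x + y) - x * Real.log x - y * Real.log y := by
    field_simp
    ring
  rw [hy'] at this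
  have hlog2 : 0 < Real.log 2 := Real.log_pos one_lt_two
  unfold entropyGain
  simp only [Real.logb]
  rw [show (x + y) * (Real.log (x + y) / Real.log 2) - x * (Real.log x / Real.log 2) -
      y * (Real.log y / Real.log 2) =
      ((x + y) * Real.log (x + y) - x * Real.log x - y * Real.log y) / Real.log 2 by ring,
    le_div_iff₀ hlog2]
  nlinarith [seven_halves_log_two_le, this, hy]

/-- `u ↦ (u+1)ln(u+1) − u ln u − u ln(5/4)` is monotone on `[1,4]` (its derivative `ln((u+1)/u) − ln(5/4)`
is `≥ 0` iff `u ≤ 4`) — the calculus behind the case-2 slope (Ellis: concavity of `F` on `[1/5,1/2]`).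
[cite: Ellis2011, §2 (p0006, "for 1/5 ≤ γ ≤ 1/2, F(1/2 − η) ≥ (10/3)(log₂5−2)η")] -/
theorem monotoneOn_succ_mul_log_sub_mul_log_sub_lin :
    MonotoneOn (fun u : ℝ => (u + 1) * Real.log (u + 1) - u * Real.log u - Real.log (5 / 4) * u)
      (Set.Icc 1 4) := by
  have hderiv : ∀ u : ℝ, 0 < u →
      HasDerivAt (fun u : ℝ => (u + 1) * Real.log (u + 1) - u * Real.log u - Real.log (5 / 4) * u)
        (Real.log (u + 1) - Real.log u - Real.log (5 / 4)) u := by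
    intro u hu
    have h1 : HasDerivAt (fun u : ℝ => (u + 1) * Real.log (u + 1)) (Real.log (u + 1) + 1) u := by
      have := (Real.hasDerivAt_mul_log (show u + 1 ≠ 0 by linarith)).comp u
        ((hasDerivAt_id u).add_const 1)
      simpa [Function.comp_def] using this
    have h2 : HasDerivAt (fun u : ℝ => u * Real.log u) (Real.log u + 1) u :=
      Real.hasDerivAt_mul_log hu.ne'
    have h3 : HasDerivAt (fun u : ℝ => Real.log (5 / 4) * u) (Real.log (5 / 4)) u := by
      simpa using (hasDerivAt_id u).const_mul (Real.log (5 / 4))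
    exact ((h1.sub h2).sub h3).congr_deriv (by ring)
  refine monotoneOn_of_deriv_nonneg (convex_Icc 1 4) ?_ ?_ ?_
  · exact (((Real.continuous_mul_log.comp (continuous_id.add continuous_const)).sub
      Real.continuous_mul_log).sub (continuous_const.mul continuous_id)).continuousOn
  · intro u hu
    rw [interior_Icc] at hu
    exact (hderiv u (by linarith [hu.1])).differentiableAt.differentiableWithinAt
  · intro u hu
    rw [interior_Icc] at hu
    have hu0 : 0 < u := by linarith [hu.1]
    rw [(hderiv u hu0).deriv]
    have h54 : Real.log (5 / 4) ≤ Real.log ((u + 1) / u) :=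
      Real.log_le_log (by norm_num) (by rw [le_div_iff₀ hu0]; linarith [hu.2])
    rw [Real.log_div (by linarith) hu0.ne'] at h54
    linarith

/-- Numeric input `(5/4)^4 ≥ 2`: `ln 2 ≤ 4 ln(5/4)`. [cite: Ellis2011, §2 (p0006)] -/
theorem log_two_le_four_mul_log : Real.log 2 ≤ 4 * Real.log (5 / 4) := by
  have h : Real.log (2 : ℝ) ≤ Real.log ((5 / 4 : ℝ) ^ 4) :=
    Real.log_le_log (by positivity) (by norm_num)
  rw [Real.log_pow] at h
  push_cast at h
  linarith

/-- **Case 2 slope** (`1/5 ≤ γ ≤ 1/2`): for `0 ≤ y ≤ x ≤ 4y`: `Φ(x,y) ≥ 2y + (x − y)/4`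
(Ellis: `F(1/2 − η) ≥ (10/3)(log₂ 5 − 2) η > η`; here with the cruder slope `1/4` in place of `> 1/2`
per unit of `(x−y)/(x+y)`). [cite: Ellis2011, §2 (p0006, "F(1/2−η) ≥ (10/3)(log₂5−2)η > η")] -/
theorem entropyGain_ge_of_le_four_mul {x y : ℝ} (hy : 0 ≤ y) (hyx : y ≤ x) (h4 : x ≤ 4 * y) :
    2 * y + 1 / 4 * (x - y) ≤ entropyGain x y := by
  rcases hy.eq_or_lt with rfl | hy0
  · have hx : x = 0 := by linarith
    subst hx
    simp [entropyGain]
  have hx0 : 0 < x := lt_of_lt_of_le hy0 hyx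
  have hu1 : (1 : ℝ) ≤ x / y := (one_le_div hy0).2 hyx
  have hu4 : x / y ≤ 4 := by rw [div_le_iff₀ hy0]; linarith
  have hmono := monotoneOn_succ_mul_log_sub_mul_log_sub_lin ⟨le_rfl, by norm_num⟩ ⟨hu1, hu4⟩ hu1
  have h2 : (1 : ℝ) + 1 = 2 := by norm_num
  simp only [h2, Real.log_one, mul_zero, sub_zero, mul_one] at hmono
  have hxy : x / y + 1 = (x + y) / y := by field_simp
  rw [hxy, Real.log_div (by linarith) hy0.ne', Real.log_div hx0.ne' hy0.ne'] at hmono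
  -- `hmono : 2 ln 2 − ln(5/4) ≤ (x+y)/y (ln(x+y) − ln y) − x/y (ln x − ln y) − ln(5/4) x/y`
  have := mul_le_mul_of_nonneg_left hmono hy
  have hy' : y * ((x + y) / y * (Real.log (x + y) - Real.log y) - x / y * (Real.log x - Real.log y) -
      Real.log (5 / 4) * (x / y)) =
      (x + y) * Real.log (x + y) - x * Real.log x - y * Real.log y - Real.log (5 / 4) * x := by
    field_simp
    ring
  rw [hy'] at this
  have hlog2 : 0 < Real.log 2 := Real.log_pos one_lt_two
  unfold entropyGain
  simp only [Real.logb]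
  rw [show (x + y) * (Real.log (x + y) / Real.log 2) - x * (Real.log x / Real.log 2) -
      y * (Real.log y / Real.log 2) =
      ((x + y) * Real.log (x + y) - x * Real.log x - y * Real.log y) / Real.log 2 by ring,
    le_div_iff₀ hlog2]
  have hxy0 : 0 ≤ x - y := by linarith
  nlinarith [log_two_le_four_mul_log, this, hy, hxy0,
    mul_le_mul_of_nonneg_left log_two_le_four_mul_log hxy0]

/-- **Lemma 5 / Remark 1, quantitative dichotomy at one coordinate.** If `exc_X(𝓕) ≤ ε|𝓕|` and the
coordinate `a ∈ X` is NOT in case 1 — both `a`-sections have more than `(2/3)ε|𝓕|` members — then the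
two sections have almost equal sizes, `||𝓕₀| − |𝓕₁|| ≤ 4ε|𝓕|` (case 2: "`1/2 − ε₀ < γ_i`"), and the
direction-`a` boundary is small, `|∂_a 𝓕| ≤ 5ε|𝓕|` ("`β_i < 6ε₀p` — the `i`th influence is small").
[cite: Ellis2011, §2 (Lemma 5 and Remark 1, p0006)] -/
theorem sections_near_of_not_small {X : Finset α} {a : α} (ha : a ∈ X) {𝓕 : Finset (Finset α)}
    (h𝓕 : ∀ S ∈ 𝓕, S ⊆ X) {ε : ℝ} (hexc : excess X 𝓕 ≤ ε * 𝓕.card)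
    (hno : ε * 𝓕.card < 3 / 2 * min ((lowerSection a 𝓕).card : ℝ) ((upperSection a 𝓕).card : ℝ)) :
    |((lowerSection a 𝓕).card : ℝ) - (upperSection a 𝓕).card| ≤ 4 * ε * 𝓕.card ∧
      (dirBoundary a 𝓕 : ℝ) ≤ 5 * ε * 𝓕.card := by
  set X' := X.erase a with hX'
  have haX' : a ∉ X' := notMem_erase a X
  have hX : X = insert a X' := (insert_erase ha).symm
  have h𝓕' : ∀ S ∈ 𝓕, S ⊆ insert a X' := fun S hS => hX ▸ h𝓕 S hS
  have h0 := excess_nonneg (subset_of_mem_lowerSection h𝓕')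
  have h1 := excess_nonneg (subset_of_mem_upperSection h𝓕')
  have hid := excess_insert haX' 𝓕
  rw [← hX] at hid
  set m₀ : ℝ := ((lowerSection a 𝓕).card : ℝ) with hm₀
  set m₁ : ℝ := ((upperSection a 𝓕).card : ℝ) with hm₁
  have hm : (𝓕.card : ℝ) = m₀ + m₁ := by
    rw [hm₀, hm₁]; exact_mod_cast (card_lowerSection_add_card_upperSection a 𝓕).symm
  have hD : (dirBoundary a 𝓕 : ℝ) =
      (lowerSection a 𝓕 \ upperSection a 𝓕).card + (upperSection a 𝓕 \ lowerSection a 𝓕).card := by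
    exact_mod_cast dirBoundary_eq_card_sdiff_add a 𝓕
  have hd0 : m₀ ≤ (lowerSection a 𝓕 \ upperSection a 𝓕).card + m₁ := by
    rw [hm₀, hm₁]; exact_mod_cast card_le_card_sdiff_add_card
  have hd1 : m₁ ≤ (upperSection a 𝓕 \ lowerSection a 𝓕).card + m₀ := by
    rw [hm₀, hm₁]; exact_mod_cast card_le_card_sdiff_add_card
  have hm₀0 : 0 ≤ m₀ := Nat.cast_nonneg _
  have hm₁0 : 0 ≤ m₁ := Nat.cast_nonneg _
  -- `Φ − m + D ≤ ε m` and `D ≥ |m₀ − m₁|`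
  rw [hm] at hexc hno hid ⊢
  have hkey : entropyGain m₀ m₁ - (m₀ + m₁) + dirBoundary a 𝓕 ≤ ε * (m₀ + m₁) := by linarith
  have hDge : |m₀ - m₁| ≤ (dirBoundary a 𝓕 : ℝ) := by
    rw [hD, abs_sub_le_iff]; constructor <;> linarith
  rcases le_total m₁ m₀ with hle | hle
  · -- `s = m₁`, `ℓ = m₀`
    rw [min_eq_right hle] at hno
    have habs : |m₀ - m₁| = m₀ - m₁ := abs_of_nonneg (by linarith)
    by_cases h4 : 4 * m₁ ≤ m₀
    · have hE := entropyGain_ge_of_four_mul_le hm₁0 h4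
      exfalso
      rw [habs] at hDge
      linarith
    · rw [not_le] at h4
      have hE := entropyGain_ge_of_le_four_mul hm₁0 hle h4.le
      rw [habs] at hDge ⊢
      have htwo := two_mul_min_le_entropyGain hm₀0 hm₁0
      rw [min_eq_right hle] at htwo
      constructor
      · linarith
      · linarith
  · -- `s = m₀`, `ℓ = m₁`
    rw [min_eq_left hle] at hno
    have habs : |m₀ - m₁| = m₁ - m₀ := by
      rw [abs_sub_comm]; exact abs_of_nonneg (by linarith)
    rw [entropyGain_comm] at hkey
    by_cases h4 : 4 * m₀ ≤ m₁
    · have hE := entropyGain_ge_of_four_mul_le hm₀0 h4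
      exfalso
      rw [habs] at hDge
      linarith
    · rw [not_le] at h4
      have hE := entropyGain_ge_of_le_four_mul hm₀0 hle h4.le
      rw [habs] at hDge ⊢
      have htwo := two_mul_min_le_entropyGain hm₁0 hm₀0
      rw [min_eq_right hle] at htwo
      constructor
      · linarith
      · linarith

/-! ### §4 Bridges: complement, translation inside a subcube, KKL on a ground set -/

/-- `S Δ {i} ⊆ X` for `S ⊆ X`, `i ∈ X`. [cite: Ellis2011, §1 (p0002)] -/
theorem symmDiff_singleton_subset {X S : Finset α} {i : α} (hS : S ⊆ X) (hi : i ∈ X) :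
    S ∆ ({i} : Finset α) ⊆ X := by
  intro y hy
  rw [mem_symmDiff, mem_singleton] at hy
  rcases hy with ⟨h, -⟩ | ⟨h, -⟩
  · exact hS h
  · rw [h]; exact hi

/-- **Taking complements inside `P(X)` preserves the edge boundary**: `|∂(P(X) ∖ 𝓕)| = |∂𝓕|`
("just apply the edge-isoperimetric inequality to `Aᶜ`: `|∂A| = |∂(Aᶜ)|`").
[cite: Ellis2011, §2 (p0007, proof of Lemma 6, "|∂A| = |∂(A^c)|")] -/
theorem edgeBoundaryIn_compl (X : Finset α) {𝓕 : Finset (Finset α)} (h𝓕 : ∀ S ∈ 𝓕, S ⊆ X) :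
    edgeBoundaryIn X (X.powerset \ 𝓕) = edgeBoundaryIn X 𝓕 := by
  unfold edgeBoundaryIn
  refine card_nbij' (fun p => (p.1 ∆ {p.2}, p.2)) (fun p => (p.1 ∆ {p.2}, p.2)) ?_ ?_ ?_ ?_
  · intro p hp
    simp only [mem_coe, mem_filter, mem_product, mem_sdiff, mem_powerset] at hp ⊢
    obtain ⟨⟨⟨hTX, hT𝓕⟩, hi⟩, hout⟩ := hp
    have hsub : p.1 ∆ {p.2} ⊆ X := symmDiff_singleton_subset hTX hi
    have hin : p.1 ∆ {p.2} ∈ 𝓕 := by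
      by_contra h
      exact hout ⟨hsub, h⟩
    refine ⟨⟨hin, hi⟩, ?_⟩
    rw [symmDiff_symmDiff_cancel_right]
    exact hT𝓕
  · intro p hp
    simp only [mem_coe, mem_filter, mem_product, mem_sdiff, mem_powerset] at hp ⊢
    obtain ⟨⟨hT𝓕, hi⟩, hout⟩ := hp
    refine ⟨⟨⟨symmDiff_singleton_subset (h𝓕 _ hT𝓕) hi, hout⟩, hi⟩, ?_⟩
    rw [symmDiff_symmDiff_cancel_right]
    exact fun h => h.2 hT𝓕
  · intro p _
    simp [symmDiff_symmDiff_cancel_right]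
  · intro p _
    simp [symmDiff_symmDiff_cancel_right]

/-- `(U Δ {i}) ∖ B = (U ∖ B) Δ {i}` for `i ∉ B`. [cite: Ellis2011, §2 (p0008, the cube C and its fixed coordinates)] -/
theorem sdiff_symmDiff_singleton {U B : Finset α} {i : α} (hi : i ∉ B) :
    (U ∆ ({i} : Finset α)) \ B = (U \ B) ∆ {i} := by
  ext x
  simp only [mem_sdiff, mem_symmDiff, mem_singleton]
  by_cases hxi : x = i
  · subst hxi; simp [hi]
  · simp [hxi]

/-- **Translation inside a subcube preserves the boundary in the moving directions**: if every member
of `𝓜` meets the fixed set `B` in the same pattern `C`, and the directions `Y` avoid `B`, then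
`|∂_Y 𝓜| = |∂_Y {U ∖ B : U ∈ 𝓜}|` (the cube `{U : U ∩ B = C}` "is" `P(Y)`).
[cite: Ellis2011, §2 (p0008, "the number of edges in ∂A between points of C is at least |B| log₂(2^{n−N}/|B|)")] -/
theorem edgeBoundaryIn_image_sdiff {Y B C : Finset α} (hYB : Disjoint Y B) {𝓜 : Finset (Finset α)}
    (h𝓜 : ∀ U ∈ 𝓜, U ∩ B = C) :
    edgeBoundaryIn Y (𝓜.image fun U => U \ B) = edgeBoundaryIn Y 𝓜 := by
  have hCB : ∀ U ∈ 𝓜, C ⊆ B := fun U hU => (h𝓜 U hU) ▸ inter_subset_right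
  have hrec : ∀ U ∈ 𝓜, U \ B ∪ C = U := fun U hU => by
    rw [← h𝓜 U hU, sdiff_union_inter]
  have hYB' : ∀ i ∈ Y, i ∉ B := fun i hi hiB => disjoint_left.1 hYB hi hiB
  -- membership in the image
  have memI : ∀ U ∈ 𝓜, ∀ i ∈ Y, ((U \ B) ∆ {i} ∈ 𝓜.image (fun U => U \ B) ↔ U ∆ {i} ∈ 𝓜) := by
    intro U hU i hi
    rw [mem_image]
    constructor
    · rintro ⟨W, hW, hWeq⟩
      have hUi : U ∆ {i} = W := by
        rw [← sdiff_union_inter (U ∆ {i}) B, ← sdiff_union_inter W B, sdiff_symmDiff_singleton (hYB' i hi),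
          ← hWeq, h𝓜 W hW]
        congr 1
        rw [← h𝓜 U hU]
        ext x
        simp only [mem_inter, mem_symmDiff, mem_singleton]
        constructor
        · rintro ⟨(⟨hx, -⟩ | ⟨rfl, -⟩), hxB⟩
          · exact ⟨hx, hxB⟩
          · exact absurd hxB (hYB' _ hi)
        · rintro ⟨hx, hxB⟩
          exact ⟨Or.inl ⟨hx, fun h => hYB' i hi (h ▸ hxB)⟩, hxB⟩
      rw [hUi]; exact hW
    · intro h
      exact ⟨U ∆ {i}, h, sdiff_symmDiff_singleton (hYB' i hi)⟩
  unfold edgeBoundaryIn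
  symm
  refine card_nbij' (fun p => (p.1 \ B, p.2)) (fun p => (p.1 ∪ C, p.2)) ?_ ?_ ?_ ?_
  · intro p hp
    simp only [mem_coe, mem_filter, mem_product] at hp ⊢
    obtain ⟨⟨hU, hi⟩, hout⟩ := hp
    exact ⟨⟨mem_image_of_mem _ hU, hi⟩, fun h => hout ((memI _ hU _ hi).1 h)⟩
  · intro p hp
    simp only [mem_coe, mem_filter, mem_product] at hp ⊢
    obtain ⟨⟨hV, hi⟩, hout⟩ := hp
    rw [mem_image] at hV
    obtain ⟨U, hU, hUV⟩ := hV
    have hp1 : p.1 ∪ C = U := by rw [← hUV]; exact hrec U hU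
    refine ⟨⟨by rw [hp1]; exact hU, hi⟩, fun h => hout ?_⟩
    rw [hp1] at h
    rw [← hUV]
    exact (memI _ hU _ hi).2 h
  · rintro ⟨U, i⟩ hp
    simp only [mem_coe, mem_filter, mem_product] at hp
    obtain ⟨⟨hU, -⟩, -⟩ := hp
    show (U \ B ∪ C, i) = (U, i)
    rw [hrec U hU]
  · rintro ⟨V, i⟩ hp
    simp only [mem_coe, mem_filter, mem_product] at hp
    obtain ⟨⟨hV, -⟩, -⟩ := hp
    rw [mem_image] at hV
    obtain ⟨U, hU, hUV⟩ := hV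
    show ((V ∪ C) \ B, i) = (V, i)
    have hUV' : U \ B = V := hUV
    rw [← hUV', hrec U hU]

/-- The translation `U ↦ U ∖ B` is injective on a family inside the cube `{U : U ∩ B = C}`.
[cite: Ellis2011, §2 (p0008)] -/
theorem card_image_sdiff_of_inter_eq {B C : Finset α} {𝓜 : Finset (Finset α)}
    (h𝓜 : ∀ U ∈ 𝓜, U ∩ B = C) : (𝓜.image fun U => U \ B).card = 𝓜.card := by
  refine card_image_of_injOn fun U hU W hW h => ?_
  have hU' := h𝓜 U (mem_coe.1 hU)
  have hW' := h𝓜 W (mem_coe.1 hW)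
  have h' : U \ B = W \ B := h
  rw [← sdiff_union_inter U B, ← sdiff_union_inter W B, hU', hW', h']

/-! #### The KKL edge-isoperimetric inequality for a family on a ground set `X` -/

section KKLBridge

open Literature.Computability.Complexity.LowDegree (cubeFourierCoeff)
open Literature.Probability.RandomGraphs.LowDegree (walsh)

/-- **KKL edge-isoperimetric inequality, family form on a ground set** (replaces Talagrand's inequality
[Ellis2011, Thm 4] in the proof of Lemma 6): for `∅ ≠ 𝓕 ⊊ P(X)` with measure `μ = |𝓕|/2^{|X|}`,
`Var = 4μ(1−μ)`, total influence `I = |∂𝓕|/2^{|X|−1}` and all influences `β_i = |∂_i𝓕|/2^{|X|−1} ≤ M`: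
`3 · Var · 3^{−I/Var} ≤ √M · I`. From the tree's proved
`Literature.Computability.Complexity.LowDegree.KKL.kkl_edge_isoperimetric` (O'Donnell §9.6) via
`X ≃ Fin |X|` and the `±1` indicator `pmIndicator`. [cite: ODonnell2014, §9.6 (KKL Edge-Isoperimetric Theorem)]
[cite: Ellis2011, §1 (Thm 4, p0005: "if all the influences are small, the edge-boundary must be very large")] -/
theorem kkl_edge_iso_family {X : Finset α} {𝓕 : Finset (Finset α)} (h𝓕 : ∀ S ∈ 𝓕, S ⊆ X)
    (h0 : 0 < 𝓕.card) (h1 : 𝓕.card < 2 ^ X.card) {M : ℝ}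
    (hM : ∀ i ∈ X, 2 * (dirBoundary i 𝓕 : ℝ) ≤ M * 2 ^ X.card) :
    3 * (4 * ((𝓕.card : ℝ) / 2 ^ X.card) * (1 - (𝓕.card : ℝ) / 2 ^ X.card)) *
        Real.exp (-(Real.log 3) * ((2 * (edgeBoundaryIn X 𝓕 : ℝ) / 2 ^ X.card) /
          (4 * ((𝓕.card : ℝ) / 2 ^ X.card) * (1 - (𝓕.card : ℝ) / 2 ^ X.card)))) ≤
      Real.sqrt M * (2 * (edgeBoundaryIn X 𝓕 : ℝ) / 2 ^ X.card) := by
  classical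
  set N := X.card with hN
  have hNpos : 0 < N := by
    rcases Nat.eq_zero_or_pos N with h | h
    · rw [h, pow_zero] at h1; omega
    · exact h
  set e : ↥X ≃ Fin N := Fintype.equivFinOfCardEq (Fintype.card_coe X) with he
  set φ : Finset α → Finset (Fin N) := fun S => univ.filter fun k => ((e.symm k : X) : α) ∈ S with hφ
  have memφ' : ∀ (S : Finset α) (k : Fin N), k ∈ φ S ↔ ((e.symm k : X) : α) ∈ S := by
    intro S k; simp [hφ]
  have memφ : ∀ (S : Finset α) (x : X), e x ∈ φ S ↔ (x : α) ∈ S := by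
    intro S x; rw [memφ', Equiv.symm_apply_apply]
  have φinj : ∀ S T : Finset α, S ⊆ X → T ⊆ X → φ S = φ T → S = T := by
    intro S T hS hT h
    ext x
    constructor
    · intro hx
      have h' := (memφ S ⟨x, hS hx⟩).2 hx
      rw [h] at h'
      exact (memφ T ⟨x, hS hx⟩).1 h'
    · intro hx
      have h' := (memφ T ⟨x, hT hx⟩).2 hx
      rw [← h] at h'
      exact (memφ S ⟨x, hT hx⟩).1 h'
  have φsymm : ∀ (S : Finset α) (x : X), φ (S ∆ {(x : α)}) = φ S ∆ {e x} := by
    intro S x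
    ext k
    rw [memφ', mem_symmDiff, mem_symmDiff, memφ', mem_singleton, mem_singleton]
    have hk : k = e x ↔ ((e.symm k : X) : α) = x := by
      constructor
      · rintro rfl; rw [Equiv.symm_apply_apply]
      · intro h
        have : e.symm k = x := Subtype.ext h
        rw [← this, Equiv.apply_symm_apply]
    rw [hk]
  set 𝓕' : Finset (Finset (Fin N)) := 𝓕.image φ with h𝓕'
  have mem𝓕' : ∀ S : Finset α, S ⊆ X → (φ S ∈ 𝓕' ↔ S ∈ 𝓕) := by
    intro S hS
    rw [h𝓕', mem_image]
    constructor
    · rintro ⟨T, hT, hTS⟩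
      rw [← φinj T S (h𝓕 T hT) hS hTS]; exact hT
    · intro h; exact ⟨S, h, rfl⟩
  have card𝓕' : 𝓕'.card = 𝓕.card := by
    rw [h𝓕']
    exact card_image_of_injOn fun S hS T hT h =>
      φinj S T (h𝓕 S (mem_coe.1 hS)) (h𝓕 T (mem_coe.1 hT)) h
  have dir𝓕' : ∀ x : X, dirBoundary (e x) 𝓕' = dirBoundary (x : α) 𝓕 := by
    intro x
    unfold dirBoundary
    have hset : 𝓕'.filter (fun A => A ∆ {e x} ∉ 𝓕') =
        (𝓕.filter fun S => S ∆ {(x : α)} ∉ 𝓕).image φ := by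
      ext A
      constructor
      · intro hA
        rw [mem_filter] at hA
        obtain ⟨hA𝓕', hAout⟩ := hA
        rw [h𝓕'] at hA𝓕'
        obtain ⟨S, hS, rfl⟩ := mem_image.1 hA𝓕'
        refine mem_image.2 ⟨S, mem_filter.2 ⟨hS, fun hin => hAout ?_⟩, rfl⟩
        rw [← φsymm S x]
        exact (mem𝓕' _ (symmDiff_singleton_subset (h𝓕 S hS) x.2)).2 hin
      · intro hA
        obtain ⟨S, hS, rfl⟩ := mem_image.1 hA
        rw [mem_filter] at hS
        refine mem_filter.2 ⟨(mem𝓕' S (h𝓕 S hS.1)).2 hS.1, fun hin => hS.2 ?_⟩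
        rw [← φsymm S x] at hin
        exact (mem𝓕' _ (symmDiff_singleton_subset (h𝓕 S hS.1) x.2)).1 hin
    rw [hset]
    exact card_image_of_injOn fun S hS T hT h =>
      φinj S T (h𝓕 S (mem_filter.1 (mem_coe.1 hS)).1) (h𝓕 T (mem_filter.1 (mem_coe.1 hT)).1) h
  have eb𝓕' : edgeBoundary 𝓕' = edgeBoundaryIn X 𝓕 := by
    rw [edgeBoundary, edgeBoundaryIn_eq_sum_dirBoundary, edgeBoundaryIn_eq_sum_dirBoundary,
      ← Equiv.sum_comp e (fun k => dirBoundary k 𝓕'), ← sum_coe_sort X]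
    exact Fintype.sum_congr _ _ fun x => dir𝓕' x
  -- the `±1` indicator of `𝓕'` and its statistics
  set F := pmIndicator 𝓕' with hF
  have hFpm := pmIndicator_eq_or 𝓕'
  have h2N : (2 : ℝ) ^ N = 2 * 2 ^ (N - 1) := by
    obtain ⟨k, hk⟩ := Nat.exists_eq_succ_of_ne_zero hNpos.ne'
    rw [hk, Nat.succ_sub_one, pow_succ]; ring
  have hI : Literature.Computability.Complexity.LowDegree.KKL.totalInfluence F =
      2 * (edgeBoundaryIn X 𝓕 : ℝ) / 2 ^ N := by
    rw [hF, totalInfluence_pmIndicator]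
    unfold totalInfluence
    rw [eb𝓕', h2N]
    field_simp
  have hmean : cubeFourierCoeff F ∅ = 1 - 2 * ((𝓕'.card : ℝ) / 2 ^ N) := by
    unfold cubeFourierCoeff
    have hw : ∀ x : Fin N → Bool, F x * walsh ∅ x = 1 - 2 * (if (univ.filter fun j => x j = true) ∈ 𝓕'
        then (1 : ℝ) else 0) := fun x => by
      rw [show walsh (∅ : Finset (Fin N)) x = 1 by simp [walsh], mul_one, hF]
      unfold pmIndicator
      split_ifs <;> norm_num
    rw [sum_congr rfl fun x _ => hw x, sum_sub_distrib, ← mul_sum,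
      sum_cube_eq_sum_powerset (fun A => if A ∈ 𝓕' then (1 : ℝ) else 0), sum_boole, sum_const,
      card_univ, Fintype.card_fun, Fintype.card_bool, Fintype.card_fin, nsmul_eq_mul, mul_one]
    rw [show (univ.filter fun A : Finset (Fin N) => A ∈ 𝓕') = 𝓕' by ext A; simp]
    push_cast
    field_simp
  have hVar : Literature.Computability.Complexity.LowDegree.KKL.variance F =
      4 * ((𝓕.card : ℝ) / 2 ^ N) * (1 - (𝓕.card : ℝ) / 2 ^ N) := by
    rw [Literature.Computability.Complexity.LowDegree.KKL.variance_eq F hFpm, hmean, card𝓕']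
    ring
  have h2N0 : (0 : ℝ) < 2 ^ N := by positivity
  have hVpos : 0 < Literature.Computability.Complexity.LowDegree.KKL.variance F := by
    rw [hVar]
    have hμ0 : 0 < (𝓕.card : ℝ) / 2 ^ N := by positivity
    have hμ1 : (𝓕.card : ℝ) / 2 ^ N < 1 := by
      rw [div_lt_one h2N0]; exact_mod_cast h1
    nlinarith
  have hInf : ∀ k, Literature.Computability.Complexity.LowDegree.KKL.influence k F ≤ M := by
    intro k
    rw [hF, influence_pmIndicator]
    have h2 := two_pow_mul_influence 𝓕' k
    have hd : (((𝓕'.filter fun A => A ∆ {k} ∉ 𝓕').card : ℕ) : ℝ) = (dirBoundary k 𝓕' : ℝ) := rfl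
    rw [hd] at h2
    have hk := dir𝓕' (e.symm k)
    rw [Equiv.apply_symm_apply] at hk
    rw [hk] at h2
    have hMk := hM _ (e.symm k).2
    have : influence k 𝓕' = 2 * (dirBoundary ((e.symm k : X) : α) 𝓕 : ℝ) / 2 ^ N := by
      rw [← h2]; field_simp
    rw [this, div_le_iff₀ h2N0]
    exact hMk
  have hkkl := Literature.Computability.Complexity.LowDegree.KKL.kkl_edge_isoperimetric F hFpm hVpos hInf
  rw [hVar, hI] at hkkl
  exact hkkl

end KKLBridge

/-- `|∂_a 𝓕| ≥ ||𝓕_a^−| − |𝓕_a^+|| = |𝓕| − 2 min(|𝓕_a^−|, |𝓕_a^+|)` ("`β_i ≥ (1 − 2γ_i)|A|/2^{n−1}`").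
[cite: Ellis2011, §2 (Remark 1, display (largeinfluence), p0006)] -/
theorem card_sub_two_min_le_dirBoundary (a : α) (𝓕 : Finset (Finset α)) :
    (𝓕.card : ℝ) - 2 * min ((lowerSection a 𝓕).card : ℝ) ((upperSection a 𝓕).card : ℝ) ≤
      dirBoundary a 𝓕 := by
  have hD : (dirBoundary a 𝓕 : ℝ) =
      (lowerSection a 𝓕 \ upperSection a 𝓕).card + (upperSection a 𝓕 \ lowerSection a 𝓕).card := by
    exact_mod_cast dirBoundary_eq_card_sdiff_add a 𝓕
  have hd0 : ((lowerSection a 𝓕).card : ℝ) ≤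
      (lowerSection a 𝓕 \ upperSection a 𝓕).card + (upperSection a 𝓕).card := by
    exact_mod_cast card_le_card_sdiff_add_card
  have hd1 : ((upperSection a 𝓕).card : ℝ) ≤
      (upperSection a 𝓕 \ lowerSection a 𝓕).card + (lowerSection a 𝓕).card := by
    exact_mod_cast card_le_card_sdiff_add_card
  have hm : (𝓕.card : ℝ) = (lowerSection a 𝓕).card + (upperSection a 𝓕).card := by
    exact_mod_cast (card_lowerSection_add_card_upperSection a 𝓕).symm
  have h0 : (0 : ℝ) ≤ (lowerSection a 𝓕 \ upperSection a 𝓕).card := Nat.cast_nonneg _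
  have h1 : (0 : ℝ) ≤ (upperSection a 𝓕 \ lowerSection a 𝓕).card := Nat.cast_nonneg _
  rcases le_total ((lowerSection a 𝓕).card : ℝ) ((upperSection a 𝓕).card : ℝ) with h | h
  · rw [min_eq_left h]; linarith
  · rw [min_eq_right h]; linarith

/-! ### §5 Lemma 6: some coordinate is in case 1 -/

/-- **The absolute constant of Lemma 6 / Theorem 7** (Ellis: "`ε ≤ c := 2^{−32K}/6`" with Talagrand's
constant `K`; with the KKL edge-isoperimetric constants of the tree, `c₆ = 10⁻⁷` suffices).
[cite: Ellis2011, §2 (Lemma 6, p0006: "which holds for all ε ≤ c := 2^{−32K}/6")] -/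
def ellisConst : ℝ := 1 / 10 ^ 7

/-- `c₆ > 0`. [cite: Ellis2011, §2 (Lemma 6, p0006)] -/
theorem ellisConst_pos : 0 < ellisConst := by
  unfold ellisConst; norm_num

/-- `c₆ = 10⁻⁷`. [cite: Ellis2011, §2 (Lemma 6, p0006)] -/
theorem ellisConst_eq : ellisConst = 1 / 10 ^ 7 := rfl

/-- `N − log₂ m = log₂(2^N/m) ≤ (2^N/m − 1)/ln 2 ≤ (3/2)(2^N − m)/m`: the bound
`m · log₂(2^N/m) ≤ (3/2)(2^N − m)` ("it is easily checked that
`2ⁿ(1−p)log₂(1/(1−p)) > 2ⁿ p(log₂(1/p) + 1 − p)` for `p ≥ 7/8`" — the part `p log₂(1/p) ≤ (1−p)/ln 2`).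
[cite: Ellis2011, §2 (proof of Lemma 6, p0007, display (toolarge))] -/
theorem card_mul_sub_logb_le {N : ℕ} {m : ℝ} (hm : 0 < m) (hmN : m ≤ 2 ^ N) :
    m * ((N : ℝ) - Real.logb 2 m) ≤ 3 / 2 * (2 ^ N - m) := by
  have hlog2 : 0 < Real.log 2 := Real.log_pos one_lt_two
  have hl2 : 2 / 3 ≤ Real.log 2 := by linarith [Real.log_two_gt_d9]
  have h2N : (0 : ℝ) < 2 ^ N := by positivity
  -- `N − log₂ m = log (2^N/m) / log 2 ≤ (2^N/m − 1)/log 2`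
  have hN : (N : ℝ) - Real.logb 2 m = Real.log (2 ^ N / m) / Real.log 2 := by
    rw [Real.log_div h2N.ne' hm.ne', Real.log_pow, Real.logb]
    field_simp
  have hle : Real.log (2 ^ N / m) ≤ 2 ^ N / m - 1 := Real.log_le_sub_one_of_pos (by positivity)
  rw [hN]
  have h1 : m * (Real.log (2 ^ N / m) / Real.log 2) ≤ m * ((2 ^ N / m - 1) / Real.log 2) := by
    gcongr
  have h2 : m * ((2 ^ N / m - 1) / Real.log 2) = (2 ^ N - m) / Real.log 2 := by
    field_simp
  rw [h2] at h1
  refine le_trans h1 ?_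
  rw [div_le_iff₀ hlog2]
  nlinarith [mul_nonneg (show (0 : ℝ) ≤ 2 ^ N - m by linarith)
    (show (0 : ℝ) ≤ Real.log 2 - 2 / 3 by linarith)]

/-- **Lemma 6, measure in `(1/2, 7/8]`** [Ellis2011]: a family of measure `p ∈ (1/2, 7/8]` with excess
`≤ ε|𝓕|` cannot have all influences `< 6εp` — Ellis: "by Theorem 4 [Talagrand], `Σ β_i > K p(1−p)
log₂(1/(6εp))` … contradicts (almostiso)". Here via the KKL edge-isoperimetric inequality
`3·Var·3^{−I/Var} ≤ √(max β)·I` with `Var ≥ μ/2`, `I ≤ 2(1+ε)μ`, `max β ≤ 10ε`, `ε ≤ 10⁻⁷`.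
[cite: Ellis2011, §2 (proof of Lemma 6, first paragraph, p0006)] [cite: ODonnell2014, §9.6 (KKL Edge-Isoperimetric Theorem)] -/
theorem no_uniformly_small_boundary_mid {X : Finset α} {𝓕 : Finset (Finset α)}
    (h𝓕X : ∀ S ∈ 𝓕, S ⊆ X) (hne : 𝓕.Nonempty) {ε : ℝ} (hε : 0 < ε) (hεc : ε ≤ 1 / 10 ^ 7)
    (hexc : excess X 𝓕 ≤ ε * 𝓕.card) (hN1 : 1 ≤ X.card) (hlt : (𝓕.card : ℝ) < 2 ^ X.card)
    (hp : 2 ^ X.card < 2 * (𝓕.card : ℝ)) (hp2 : 8 * (𝓕.card : ℝ) ≤ 7 * 2 ^ X.card)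
    (hnear : ∀ i ∈ X, (dirBoundary i 𝓕 : ℝ) ≤ 5 * ε * 𝓕.card) : False := by
  classical
  have hm0 : 0 < (𝓕.card : ℝ) := by exact_mod_cast hne.card_pos
  have h2N : (0 : ℝ) < 2 ^ X.card := by positivity
  have hεmT : ε * (𝓕.card : ℝ) ≤ ε * 2 ^ X.card := mul_le_mul_of_nonneg_left hlt.le hε.le
  have h1' : 𝓕.card < 2 ^ X.card := by exact_mod_cast hlt
  have hM : ∀ i ∈ X, 2 * (dirBoundary i 𝓕 : ℝ) ≤ 10 * ε * 2 ^ X.card := by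
    intro i hi
    have := hnear i hi
    linarith
  have hkkl := kkl_edge_iso_family h𝓕X hne.card_pos h1' hM
  set T : ℝ := (2 : ℝ) ^ X.card with hT
  set μ : ℝ := (𝓕.card : ℝ) / T with hμ
  set V : ℝ := 4 * μ * (1 - μ) with hV
  set I : ℝ := 2 * (edgeBoundaryIn X 𝓕 : ℝ) / T with hI
  have hμlo : 1 / 2 < μ := by rw [hμ, lt_div_iff₀ h2N]; linarith
  have hμhi : μ ≤ 7 / 8 := by rw [hμ, div_le_iff₀ h2N]; linarith
  have hεμ : ε * μ ≤ 1 / 10 ^ 7 * μ := mul_le_mul_of_nonneg_right hεc (by linarith)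
  have hVlo : μ / 2 ≤ V := by
    rw [hV]
    nlinarith [mul_nonneg (show (0 : ℝ) ≤ μ by linarith) (show (0 : ℝ) ≤ 7 / 2 - 4 * μ by linarith)]
  have hVpos : 0 < V := by linarith
  -- `I ≤ 2(1+ε)μ`: `|∂𝓕| = exc + m(N − log₂ m) ≤ εm + m`
  have hNlog : (X.card : ℝ) - Real.logb 2 𝓕.card ≤ 1 := by
    -- `log₂ m ≥ N − 1` since `m ≥ 2^{N−1}`
    have hm2 : (2 : ℝ) ^ (X.card - 1) ≤ 𝓕.card := by
      have : (2 : ℝ) ^ (X.card - 1) * 2 = 2 ^ X.card := by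
        rw [← pow_succ, Nat.sub_add_cancel hN1]
      nlinarith
    have hlb : ((X.card - 1 : ℕ) : ℝ) ≤ Real.logb 2 𝓕.card := by
      rw [Real.le_logb_iff_rpow_le one_lt_two hm0, Real.rpow_natCast]
      exact hm2
    rw [Nat.cast_sub hN1, Nat.cast_one] at hlb
    linarith
  have heB : (edgeBoundaryIn X 𝓕 : ℝ) ≤ (1 + ε) * 𝓕.card := by
    have hdef : (edgeBoundaryIn X 𝓕 : ℝ) =
        excess X 𝓕 + 𝓕.card * ((X.card : ℝ) - Real.logb 2 𝓕.card) := by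
      unfold excess; ring
    rw [hdef]
    have : (𝓕.card : ℝ) * ((X.card : ℝ) - Real.logb 2 𝓕.card) ≤ 𝓕.card * 1 :=
      mul_le_mul_of_nonneg_left hNlog hm0.le
    linarith
  have hIle : I ≤ 2 * (1 + ε) * μ := by
    have hdiv : 2 * (edgeBoundaryIn X 𝓕 : ℝ) / T ≤ (2 * (1 + ε) * 𝓕.card) / T :=
      div_le_div_of_nonneg_right (by linarith) h2N.le
    calc I = 2 * (edgeBoundaryIn X 𝓕 : ℝ) / T := rfl
      _ ≤ (2 * (1 + ε) * 𝓕.card) / T := hdiv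
      _ = 2 * (1 + ε) * μ := by rw [hμ]; ring
  have hI0 : 0 ≤ I := by rw [hI]; positivity
  have hI5V : I ≤ 5 * V := by linarith
  -- `exp(−log 3 · I/V) ≥ 3^{−5} = 1/243`
  have hlog3 : 0 < Real.log 3 := Real.log_pos (by norm_num)
  have hexp : (1 : ℝ) / 243 ≤ Real.exp (-(Real.log 3) * (I / V)) := by
    have hIV : I / V ≤ 5 := by rw [div_le_iff₀ hVpos]; linarith
    have h243 : Real.exp (-(Real.log 3) * 5) = 1 / 243 := by
      rw [show -(Real.log 3) * 5 = -(Real.log ((3:ℝ) ^ 5)) by rw [Real.log_pow]; push_cast; ring,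
        Real.exp_neg, Real.exp_log (by positivity)]
      norm_num
    rw [← h243]
    have := mul_le_mul_of_nonneg_left hIV hlog3.le
    exact Real.exp_le_exp.2 (by linarith)
  -- `√(10ε) ≤ 1/1000`
  have hsqrt : Real.sqrt (10 * ε) ≤ 1 / 1000 := by
    rw [show (1 : ℝ) / 1000 = Real.sqrt ((1 / 1000) ^ 2) by rw [Real.sqrt_sq (by norm_num)]]
    exact Real.sqrt_le_sqrt (by norm_num at hεc ⊢; linarith)
  have hsqrt0 : 0 ≤ Real.sqrt (10 * ε) := Real.sqrt_nonneg _
  -- assemble: `3 V e ≥ 3 (μ/2)/243 > 1/324 ≥ (1/1000)(7/4)(1+ε) ≥ √(10ε) I`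
  have hL : 3 * (μ / 2) * (1 / 243) ≤ 3 * V * Real.exp (-(Real.log 3) * (I / V)) := by
    have := mul_le_mul hVlo hexp (by norm_num) hVpos.le
    linarith
  have hR : Real.sqrt (10 * ε) * I ≤ 1 / 1000 * (2 * (1 + ε) * μ) := by
    exact mul_le_mul hsqrt hIle hI0 (by norm_num)
  have hkkl' : 3 * V * Real.exp (-(Real.log 3) * (I / V)) ≤ Real.sqrt (10 * ε) * I := hkkl
  linarith

/-- **Lemma 6, measure `> 7/8`** [Ellis2011]: "any set `A ⊂ {0,1}ⁿ` with measure `p ∈ [7/8, 1−ε]` has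
`|∂A| > |A|(log₂(2ⁿ/|A|) + ε)` … just apply the edge-isoperimetric inequality to `Aᶜ`".
[cite: Ellis2011, §2 (proof of Lemma 6, display (toolarge), p0006–p0007)] -/
theorem excess_large_of_measure_gt {X : Finset α} {𝓕 : Finset (Finset α)}
    (h𝓕X : ∀ S ∈ 𝓕, S ⊆ X) (hne : 𝓕.Nonempty) {ε : ℝ} (hε : 0 < ε)
    (hcard : (𝓕.card : ℝ) ≤ (1 - ε) * 2 ^ X.card) (hexc : excess X 𝓕 ≤ ε * 𝓕.card)
    (hp2 : 7 * 2 ^ X.card < 8 * (𝓕.card : ℝ)) : False := by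
  classical
  have hm0 : 0 < (𝓕.card : ℝ) := by exact_mod_cast hne.card_pos
  have h2N : (0 : ℝ) < 2 ^ X.card := by positivity
  have hlt : (𝓕.card : ℝ) < 2 ^ X.card := by
    have := mul_pos hε h2N; linarith
  have hεmT : ε * (𝓕.card : ℝ) ≤ ε * 2 ^ X.card := mul_le_mul_of_nonneg_left hlt.le hε.le
  set 𝓒 : Finset (Finset α) := X.powerset \ 𝓕 with h𝓒
  have h𝓕P : 𝓕 ⊆ X.powerset := fun S hS => mem_powerset.2 (h𝓕X S hS)
  have h𝓒X : ∀ S ∈ 𝓒, S ⊆ X := fun S hS => mem_powerset.1 (mem_sdiff.1 hS).1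
  have hc𝓒 : (𝓒.card : ℝ) = 2 ^ X.card - 𝓕.card := by
    rw [h𝓒, card_sdiff_of_subset h𝓕P, card_powerset, Nat.cast_sub, Nat.cast_pow, Nat.cast_two]
    rw [← card_powerset]; exact card_le_card h𝓕P
  have heq := edgeBoundaryIn_compl X h𝓕X
  have hHarper := card_mul_sub_logb_le_edgeBoundaryIn X 𝓒 h𝓒X
  rw [heq, hc𝓒] at hHarper
  -- `m' := 2^N − m ≥ ε 2^N > 0` and `m' < 2^N/8`, so `log₂ m' ≤ N − 3`
  have hm'pos : 0 < (2 : ℝ) ^ X.card - 𝓕.card := by linarith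
  have hlogm' : Real.logb 2 ((2 : ℝ) ^ X.card - 𝓕.card) ≤ X.card - 3 := by
    have h8 : (2 : ℝ) ^ X.card - 𝓕.card ≤ 2 ^ X.card / 8 := by linarith
    have := Real.logb_le_logb_of_le one_lt_two hm'pos h8
    refine le_trans this (le_of_eq ?_)
    rw [Real.logb_div h2N.ne' (by norm_num), show (8 : ℝ) = 2 ^ (3 : ℕ) by norm_num,
      Real.logb_pow, Real.logb_pow, Real.logb_self_eq_one one_lt_two]
    push_cast; ring
  -- `|∂𝓕| = exc + m(N − log₂ m) ≤ ε m + (3/2)(2^N − m)`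
  have hdef : (edgeBoundaryIn X 𝓕 : ℝ) =
      excess X 𝓕 + 𝓕.card * ((X.card : ℝ) - Real.logb 2 𝓕.card) := by
    unfold excess; ring
  have hml := card_mul_sub_logb_le (N := X.card) hm0 hlt.le
  -- combine: `3 m' ≤ m'(N − log₂ m') ≤ |∂𝓕| ≤ ε m + (3/2) m'` and `m' ≥ ε 2^N ≥ ε m`
  have h3 : ((2 : ℝ) ^ X.card - 𝓕.card) * 3 ≤
      ((2 : ℝ) ^ X.card - 𝓕.card) * ((X.card : ℝ) - Real.logb 2 ((2 : ℝ) ^ X.card - 𝓕.card)) :=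
    mul_le_mul_of_nonneg_left (by linarith) hm'pos.le
  have hεT0 : 0 < ε * (2 : ℝ) ^ X.card := mul_pos hε h2N
  linarith

/-- **Lemma 6** [Ellis2011]: "There exists an absolute constant `c > 0` such that the following holds.
If `ε ≤ c`, and `A ⊂ {0,1}ⁿ` with measure `|A|/2ⁿ ≤ 1 − ε` and `|∂A| ≤ |A|(log₂(2ⁿ/|A|) + ε)`, then
case 1 must occur for some `i ∈ [n]`, i.e. `γ_i ≤ ε/(5(log₂5 − 2))`" — here with `c = c₆ = 10⁻⁷`,
`0 < ε`, nonempty `A` and the case-1 threshold `γ_a ≤ (2/3)ε` (`(3/2)·min(|𝓕_a^−|,|𝓕_a^+|) ≤ ε|𝓕|`).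
Proof as printed: by (strong) induction on the ground set; if no coordinate is in case 1 then all
influences are small (`sections_near_of_not_small`); measure `≤ 1/2`: descend to a section with small
excess and lift its case-1 coordinate (contradiction); measure in `(1/2, 7/8]`: the KKL
edge-isoperimetric inequality (for Talagrand's); measure `> 7/8`: the complement has too large a boundary.
[cite: Ellis2011, §2 (Lemma 6 and its proof, p0006–p0007)] -/
theorem exists_small_section {ε : ℝ} (hε : 0 < ε) (hεc : ε ≤ ellisConst) :
    ∀ (X : Finset α) (𝓕 : Finset (Finset α)), (∀ S ∈ 𝓕, S ⊆ X) → 𝓕.Nonempty →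
      (𝓕.card : ℝ) ≤ (1 - ε) * 2 ^ X.card → excess X 𝓕 ≤ ε * 𝓕.card →
      ∃ a ∈ X, 3 / 2 * min ((lowerSection a 𝓕).card : ℝ) ((upperSection a 𝓕).card : ℝ) ≤
        ε * 𝓕.card := by
  intro X
  induction X using Finset.strongInduction with
  | H X ih =>
  intro 𝓕 h𝓕X hne hcard hexc
  rw [ellisConst_eq] at hεc
  have hm0 : 0 < (𝓕.card : ℝ) := by exact_mod_cast hne.card_pos
  have hεm : ε * (𝓕.card : ℝ) ≤ 1 / 10 ^ 7 * 𝓕.card := mul_le_mul_of_nonneg_right hεc hm0.le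
  have hεm0 : 0 < ε * (𝓕.card : ℝ) := mul_pos hε hm0
  by_contra hno
  push Not at hno
  -- (A) every coordinate is in case 2: sections nearly equal, directional boundary small
  have hnear : ∀ a ∈ X, |((lowerSection a 𝓕).card : ℝ) - (upperSection a 𝓕).card| ≤ 4 * ε * 𝓕.card ∧
      (dirBoundary a 𝓕 : ℝ) ≤ 5 * ε * 𝓕.card :=
    fun a ha => sections_near_of_not_small ha h𝓕X hexc (hno a ha)
  -- the ground set is nonempty
  have hXne : X.Nonempty := by
    rw [nonempty_iff_ne_empty]
    rintro rfl
    simp only [card_empty, pow_zero, mul_one] at hcard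
    have : (1 : ℝ) ≤ 𝓕.card := by exact_mod_cast hne.card_pos
    linarith
  have hN1 : 1 ≤ X.card := hXne.card_pos
  have h2N : (0 : ℝ) < 2 ^ X.card := by positivity
  have hε2N : ε * (2 : ℝ) ^ X.card ≤ 1 / 10 ^ 7 * 2 ^ X.card :=
    mul_le_mul_of_nonneg_right hεc h2N.le
  have hlt : (𝓕.card : ℝ) < 2 ^ X.card := by
    have := mul_pos hε h2N; linarith
  have hεmT : ε * (𝓕.card : ℝ) ≤ ε * 2 ^ X.card := mul_le_mul_of_nonneg_left hlt.le hε.le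
  by_cases hp : 2 * (𝓕.card : ℝ) ≤ 2 ^ X.card
  · /- measure `≤ 1/2`: descend along any coordinate `a` to a section with small excess -/
    obtain ⟨a, ha⟩ := hXne
    set X' := X.erase a with hX'
    have haX' : a ∉ X' := notMem_erase a X
    have hXa : X = insert a X' := (insert_erase ha).symm
    have hX'sub : X' ⊂ X := erase_ssubset ha
    have h2X' : (2 : ℝ) ^ X'.card * 2 = 2 ^ X.card := by
      rw [hX', card_erase_of_mem ha, ← pow_succ, Nat.sub_add_cancel hN1]
    have h𝓕' : ∀ S ∈ 𝓕, S ⊆ insert a X' := fun S hS => hXa ▸ h𝓕X S hS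
    have hlow := subset_of_mem_lowerSection h𝓕'
    have hupp := subset_of_mem_upperSection h𝓕'
    have h0 := excess_nonneg hlow
    have h1 := excess_nonneg hupp
    have hsec := excess_sections_le haX' 𝓕
    rw [← hXa] at hsec
    set m₀ : ℝ := ((lowerSection a 𝓕).card : ℝ) with hm₀
    set m₁ : ℝ := ((upperSection a 𝓕).card : ℝ) with hm₁
    have hsum : (𝓕.card : ℝ) = m₀ + m₁ := by
      rw [hm₀, hm₁]; exact_mod_cast (card_lowerSection_add_card_upperSection a 𝓕).symm
    have hm₀0 : 0 ≤ m₀ := Nat.cast_nonneg _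
    have hm₁0 : 0 ≤ m₁ := Nat.cast_nonneg _
    have htwo := two_mul_min_le_entropyGain hm₀0 hm₁0
    have hεsum : ε * (𝓕.card : ℝ) = ε * m₀ + ε * m₁ := by rw [hsum]; ring
    obtain ⟨hnear_a, -⟩ := hnear a ha
    have hno_a := hno a ha
    have hεm2X' : ε * (𝓕.card : ℝ) ≤ ε * 2 ^ X'.card :=
      mul_le_mul_of_nonneg_left (by linarith) hε.le
    have hε2X' : ε * (2 : ℝ) ^ X'.card ≤ 1 / 10 ^ 7 * 2 ^ X'.card :=
      mul_le_mul_of_nonneg_right hεc (by positivity)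
    -- both sections have at most `(1 − ε) 2^{|X'|}` members
    have hsize : ∀ m' : ℝ, m' ≤ max m₀ m₁ → m' ≤ (1 - ε) * 2 ^ X'.card := by
      intro m' hm'
      have hmax : max m₀ m₁ ≤ ((𝓕.card : ℝ) + |m₀ - m₁|) / 2 := by
        rw [hsum]
        rcases le_total m₀ m₁ with h | h
        · rw [max_eq_right h, abs_sub_comm, abs_of_nonneg (by linarith)]; linarith
        · rw [max_eq_left h, abs_of_nonneg (by linarith)]; linarith
      linarith
    -- one of the sections has excess at most `ε` times its size
    have hchoice : excess X' (lowerSection a 𝓕) ≤ ε * m₀ ∨ excess X' (upperSection a 𝓕) ≤ ε * m₁ := by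
      by_contra h
      push Not at h
      linarith [h.1, h.2]
    -- the generic contradiction: a case-1 coordinate `j` of a section `𝓖` of size `m' ≥ min`,
    -- with `|∂_j 𝓖| ≤ |∂_j 𝓕|`, has `|∂_j 𝓕| ≥ m' − (4/3) ε m'`, but `|∂_j 𝓕| ≤ 5 ε |𝓕|`
    have hcontra : ∀ (𝓖 : Finset (Finset α)) (m' : ℝ), (𝓖.card : ℝ) = m' → min m₀ m₁ ≤ m' →
        m' ≤ 𝓕.card →
        (∀ j ∈ X', (dirBoundary j 𝓖 : ℝ) ≤ dirBoundary j 𝓕) →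
        (∃ j ∈ X', 3 / 2 * min ((lowerSection j 𝓖).card : ℝ) ((upperSection j 𝓖).card : ℝ) ≤
          ε * 𝓖.card) → False := by
      intro 𝓖 m' hcard' hmin hle hdir hj
      obtain ⟨j, hj, hjmin⟩ := hj
      have hjX : j ∈ X := mem_of_mem_erase hj
      have hDj := (hnear j hjX).2
      have hDj' := hdir j hj
      have hD𝓖 := card_sub_two_min_le_dirBoundary j 𝓖
      rw [hcard'] at hjmin hD𝓖
      have hεm' : ε * m' ≤ ε * 𝓕.card := mul_le_mul_of_nonneg_left hle hε.le
      -- `min m₀ m₁ ≥ (|𝓕| − |m₀ − m₁|)/2 ≥ (|𝓕| − 4ε|𝓕|)/2`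
      have hmin' : ((𝓕.card : ℝ) - |m₀ - m₁|) / 2 ≤ min m₀ m₁ := by
        rw [hsum]
        rcases le_total m₀ m₁ with h | h
        · rw [min_eq_left h, abs_sub_comm, abs_of_nonneg (by linarith)]; linarith
        · rw [min_eq_right h, abs_of_nonneg (by linarith)]; linarith
      linarith
    rcases hchoice with hc | hc
    · have hne' : (lowerSection a 𝓕).Nonempty := by
        rw [← card_pos, ← Nat.cast_pos (α := ℝ)]
        exact lt_of_lt_of_le (by linarith [min_le_left m₀ m₁]) (le_refl m₀)
      refine hcontra (lowerSection a 𝓕) m₀ rfl (min_le_left _ _) (by linarith) ?_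
        (ih X' hX'sub (lowerSection a 𝓕) hlow hne' (hsize m₀ (le_max_left _ _)) hc)
      intro j hj
      have hja : j ≠ a := fun h => haX' (h ▸ hj)
      rw [dirBoundary_eq_add_of_ne hja 𝓕]
      push_cast
      linarith [(Nat.cast_nonneg (dirBoundary j (upperSection a 𝓕)) : (0:ℝ) ≤ _)]
    · have hne' : (upperSection a 𝓕).Nonempty := by
        rw [← card_pos, ← Nat.cast_pos (α := ℝ)]
        exact lt_of_lt_of_le (by linarith [min_le_right m₀ m₁]) (le_refl m₁)
      refine hcontra (upperSection a 𝓕) m₁ rfl (min_le_right _ _) (by linarith) ?_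
        (ih X' hX'sub (upperSection a 𝓕) hupp hne' (hsize m₁ (le_max_right _ _)) hc)
      intro j hj
      have hja : j ≠ a := fun h => haX' (h ▸ hj)
      rw [dirBoundary_eq_add_of_ne hja 𝓕]
      push_cast
      linarith [(Nat.cast_nonneg (dirBoundary j (lowerSection a 𝓕)) : (0:ℝ) ≤ _)]
  · rw [not_le] at hp
    by_cases hp2 : 8 * (𝓕.card : ℝ) ≤ 7 * 2 ^ X.card
    · /- measure in `(1/2, 7/8]`: the KKL edge-isoperimetric inequality -/
      exact no_uniformly_small_boundary_mid h𝓕X hne hε hεc hexc hN1 hlt hp hp2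
        (fun i hi => (hnear i hi).2)
    · /- measure `> 7/8`: the complement has too large a boundary -/
      rw [not_le] at hp2
      exact excess_large_of_measure_gt h𝓕X hne hε hcard hexc hp2

/-! ### §6 Theorem 7: rough stability -/

/-- **The subcube of `P(X)` with fixed coordinates `B` and pattern `C`**: `{S ⊆ X : S ∩ B = C}` (Ellis: "a
`d`-dimensional subcube … fixed coordinates … moving coordinates"; for `X = [n]` this is the tree's
`subcube B C`). [cite: Ellis2011, §1 (p0001, definition of a subcube)] -/
def cubeIn (X B C : Finset α) : Finset (Finset α) := X.powerset.filter fun S => S ∩ B = C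

/-- Membership in `cubeIn`. [cite: Ellis2011, §1 (p0001)] -/
theorem mem_cubeIn {X B C S : Finset α} : S ∈ cubeIn X B C ↔ S ⊆ X ∧ S ∩ B = C := by
  rw [cubeIn, mem_filter, mem_powerset]

/-- No fixed coordinate: the whole cube `P(X)`. [cite: Ellis2011, §1 (p0001)] -/
theorem cubeIn_empty (X : Finset α) : cubeIn X ∅ ∅ = X.powerset := by
  ext S
  rw [mem_cubeIn, mem_powerset]
  simp

/-- **A subcube with `|B|` fixed coordinates has `2^{|X| − |B|}` points.** [cite: Ellis2011, §1 (p0001, "d-dimensional subcube … n − d is called the codimension")] -/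
theorem card_cubeIn {X B C : Finset α} (hB : B ⊆ X) (hC : C ⊆ B) :
    (cubeIn X B C).card = 2 ^ (X.card - B.card) := by
  rw [← card_sdiff_of_subset hB, ← card_powerset]
  have hTB : ∀ T : Finset α, T ⊆ X \ B → Disjoint T B := fun T hT =>
    disjoint_of_subset_left hT sdiff_disjoint
  refine card_nbij' (fun S => S \ B) (fun T => T ∪ C) ?_ ?_ ?_ ?_
  · intro S hS
    rw [mem_coe, mem_cubeIn] at hS
    rw [mem_coe, mem_powerset]
    exact sdiff_subset_sdiff hS.1 subset_rfl
  · intro T hT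
    rw [mem_coe, mem_powerset] at hT
    rw [mem_coe, mem_cubeIn]
    refine ⟨union_subset (hT.trans sdiff_subset) (hC.trans hB), ?_⟩
    rw [union_inter_distrib_right, disjoint_iff_inter_eq_empty.1 (hTB T hT), empty_union,
      inter_eq_left.2 hC]
  · intro S hS
    rw [mem_coe, mem_cubeIn] at hS
    show S \ B ∪ C = S
    rw [← hS.2, sdiff_union_inter]
  · intro T hT
    rw [mem_coe, mem_powerset] at hT
    show (T ∪ C) \ B = T
    rw [union_sdiff_distrib, (hTB T hT).sdiff_eq_left, sdiff_eq_empty_iff_subset.2 hC, union_empty]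

/-- Lifting a subcube of `P(X')` along a new coordinate `a` fixed to `0`: the same family.
[cite: Ellis2011, §2 (proof of Thm 7, p0007–p0008: "C = P([n−N]), a codimension-N subcube")] -/
theorem cubeIn_insert_left {X' B' C' : Finset α} {a : α} (ha : a ∉ X') (hB : B' ⊆ X')
    (hC : C' ⊆ B') : cubeIn (insert a X') (insert a B') C' = cubeIn X' B' C' := by
  ext S
  rw [mem_cubeIn, mem_cubeIn]
  constructor
  · rintro ⟨hSX, hSB⟩
    have haS : a ∉ S := fun h => ha (hB (hC (hSB ▸ mem_inter.2 ⟨h, mem_insert_self a B'⟩)))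
    refine ⟨(subset_insert_iff_of_notMem haS).1 hSX, ?_⟩
    rwa [inter_insert_of_notMem haS] at hSB
  · rintro ⟨hSX, hSB⟩
    have haS : a ∉ S := fun h => ha (hSX h)
    refine ⟨hSX.trans (subset_insert a X'), ?_⟩
    rwa [inter_insert_of_notMem haS]

/-- Lifting a subcube of `P(X')` along a new coordinate `a` fixed to `1`: the translate by `{a}`.
[cite: Ellis2011, §2 (proof of Thm 7, p0007–p0008)] -/
theorem cubeIn_insert_right {X' B' C' : Finset α} {a : α} (ha : a ∉ X') (hB : B' ⊆ X')
    (hC : C' ⊆ B') :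
    cubeIn (insert a X') (insert a B') (insert a C') = (cubeIn X' B' C').image (insert a) := by
  have haB : a ∉ B' := fun h => ha (hB h)
  have haC : a ∉ C' := fun h => haB (hC h)
  ext S
  rw [mem_cubeIn, mem_image]
  constructor
  · rintro ⟨hSX, hSB⟩
    have haS : a ∈ S := (mem_inter.1 (hSB.symm ▸ mem_insert_self a C')).1
    refine ⟨S.erase a, mem_cubeIn.2 ⟨?_, ?_⟩, insert_erase haS⟩
    · intro x hx
      rw [mem_erase] at hx
      exact mem_of_mem_insert_of_ne (hSX hx.2) hx.1
    · have h1 : S.erase a ∩ B' = (S ∩ insert a B').erase a := by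
        ext x
        simp only [mem_inter, mem_erase, mem_insert]
        constructor
        · rintro ⟨⟨hxa, hxS⟩, hxB⟩; exact ⟨hxa, hxS, Or.inr hxB⟩
        · rintro ⟨hxa, hxS, (rfl | hxB)⟩
          · exact absurd rfl hxa
          · exact ⟨⟨hxa, hxS⟩, hxB⟩
      rw [h1, hSB, erase_insert haC]
  · rintro ⟨T, hT, rfl⟩
    rw [mem_cubeIn] at hT
    refine ⟨insert_subset_insert a hT.1, ?_⟩
    rw [← insert_inter_distrib, hT.2]

omit [DecidableEq α] in
/-- Members of a family of subsets of `X'` avoid any `a ∉ X'`. [cite: Ellis2011, §1 (p0002)] -/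
theorem notMem_of_subset {X' : Finset α} {a : α} (ha : a ∉ X') {𝓢 : Finset (Finset α)}
    (h𝓢 : ∀ S ∈ 𝓢, S ⊆ X') : ∀ S ∈ 𝓢, a ∉ S := fun S hS h => ha (h𝓢 S hS h)

/-- Intersecting with a family avoiding `a` only sees the lower `a`-section.
[cite: Ellis2011, §2 (proof of Thm 7, p0008: "|A ∖ C| = |A ∖ B^{(N)}|")] -/
theorem inter_eq_lowerSection_inter {a : α} {𝓕 𝓢 : Finset (Finset α)} (h𝓢 : ∀ S ∈ 𝓢, a ∉ S) :
    𝓕 ∩ 𝓢 = lowerSection a 𝓕 ∩ 𝓢 := by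
  ext S
  rw [mem_inter, mem_inter, mem_lowerSection]
  constructor
  · rintro ⟨hS𝓕, hS𝓢⟩; exact ⟨⟨hS𝓕, h𝓢 S hS𝓢⟩, hS𝓢⟩
  · rintro ⟨⟨hS𝓕, -⟩, hS𝓢⟩; exact ⟨hS𝓕, hS𝓢⟩

/-- Intersecting with the `{a}`-translate of a family avoiding `a` only sees the upper `a`-section.
[cite: Ellis2011, §2 (proof of Thm 7, p0008)] -/
theorem card_inter_image_insert {a : α} {𝓕 𝓢 : Finset (Finset α)} (h𝓢 : ∀ S ∈ 𝓢, a ∉ S) :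
    (𝓕 ∩ 𝓢.image (insert a)).card = (upperSection a 𝓕 ∩ 𝓢).card := by
  have hset : 𝓕 ∩ 𝓢.image (insert a) = (upperSection a 𝓕 ∩ 𝓢).image (insert a) := by
    ext S
    rw [mem_inter, mem_image, mem_image]
    constructor
    · rintro ⟨hS𝓕, T, hT, rfl⟩
      exact ⟨T, mem_inter.2 ⟨mem_upperSection.2 ⟨h𝓢 T hT, hS𝓕⟩, hT⟩, rfl⟩
    · rintro ⟨T, hT, rfl⟩
      rw [mem_inter, mem_upperSection] at hT
      exact ⟨hT.1.2, T, hT.2, rfl⟩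
  rw [hset]
  refine card_image_of_injOn fun T hT U hU h => ?_
  have haT : a ∉ T := h𝓢 T (mem_inter.1 (mem_coe.1 hT)).2
  have haU : a ∉ U := h𝓢 U (mem_inter.1 (mem_coe.1 hU)).2
  have h' : insert a T = insert a U := h
  rw [← erase_insert haT, h', erase_insert haU]

/-- Translating a family avoiding `a` by `{a}` preserves its size. [cite: Ellis2011, §1 (p0002)] -/
theorem card_image_insert {a : α} {𝓢 : Finset (Finset α)} (h𝓢 : ∀ S ∈ 𝓢, a ∉ S) :
    (𝓢.image (insert a)).card = 𝓢.card := by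
  refine card_image_of_injOn fun T hT U hU h => ?_
  have haT : a ∉ T := h𝓢 T (mem_coe.1 hT)
  have haU : a ∉ U := h𝓢 U (mem_coe.1 hU)
  have h' : insert a T = insert a U := h
  rw [← erase_insert haT, h', erase_insert haU]

/-- **Theorem 7 (rough stability)** [Ellis2011]: "There exists an absolute constant `c > 0` such that if
`A ⊂ {0,1}ⁿ` with `|∂A| ≤ |A| log₂(2ⁿ/|A|) + ε|A|` for some `ε ≤ c`, then `|A Δ C|/|A| < 3ε` for some
subcube `C`." Typed in the form the proof delivers (iterate Lemma 6: pass to the larger section of a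
case-1 coordinate until the measure exceeds `1 − ε`; `C` = the cube of the remaining ground set):
for `0 < ε ≤ c₆`, nonempty `𝓕 ⊆ P(X)` with `exc(𝓕) ≤ ε|𝓕|` there is a subcube `S = cubeIn X B C` with
`(3/2)|𝓕 ∖ S| ≤ exc(𝓕)` ("`|A ∖ C| ≤ ε₀|A|/(5(log₂5−2))`") and `|𝓕 ∩ S| > (1 − ε)|S|` ("`p^{(N)} > 1 − ε₀`").
[cite: Ellis2011, §2 (Theorem 7 and its proof, p0007–p0008)] -/
theorem rough_stability {ε : ℝ} (hε : 0 < ε) (hεc : ε ≤ ellisConst) :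
    ∀ (X : Finset α) (𝓕 : Finset (Finset α)), (∀ S ∈ 𝓕, S ⊆ X) → 𝓕.Nonempty →
      excess X 𝓕 ≤ ε * 𝓕.card →
      ∃ B ⊆ X, ∃ C ⊆ B, 3 / 2 * ((𝓕 \ cubeIn X B C).card : ℝ) ≤ excess X 𝓕 ∧
        (1 - ε) * ((cubeIn X B C).card : ℝ) < ((𝓕 ∩ cubeIn X B C).card : ℝ) := by
  intro X
  induction X using Finset.strongInduction with
  | H X ih =>
  intro 𝓕 h𝓕X hne hexc
  have hεc' : ε ≤ 1 / 10 ^ 7 := hεc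
  have h𝓕P : 𝓕 ⊆ X.powerset := fun S hS => mem_powerset.2 (h𝓕X S hS)
  by_cases hbig : (1 - ε) * (2 : ℝ) ^ X.card < 𝓕.card
  · refine ⟨∅, empty_subset _, ∅, subset_rfl, ?_, ?_⟩
    · rw [cubeIn_empty, sdiff_eq_empty_iff_subset.2 h𝓕P, card_empty, Nat.cast_zero, mul_zero]
      exact excess_nonneg h𝓕X
    · rw [cubeIn_empty, card_powerset, inter_eq_left.2 h𝓕P]
      push_cast
      exact hbig
  rw [not_lt] at hbig
  obtain ⟨a, ha, hmin⟩ := exists_small_section hε hεc X 𝓕 h𝓕X hne hbig hexc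
  set X' := X.erase a with hX'
  have haX' : a ∉ X' := notMem_erase a X
  have hXa : X = insert a X' := (insert_erase ha).symm
  have hX'sub : X' ⊂ X := erase_ssubset ha
  have h𝓕' : ∀ S ∈ 𝓕, S ⊆ insert a X' := fun S hS => hXa ▸ h𝓕X S hS
  have hlow := subset_of_mem_lowerSection h𝓕'
  have hupp := subset_of_mem_upperSection h𝓕'
  have h0 := excess_nonneg hlow
  have h1 := excess_nonneg hupp
  have hsec := excess_sections_le haX' 𝓕
  rw [← hXa] at hsec
  set m₀ : ℝ := ((lowerSection a 𝓕).card : ℝ) with hm₀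
  set m₁ : ℝ := ((upperSection a 𝓕).card : ℝ) with hm₁
  have hsumN : 𝓕.card = (lowerSection a 𝓕).card + (upperSection a 𝓕).card :=
    (card_lowerSection_add_card_upperSection a 𝓕).symm
  have hsum : (𝓕.card : ℝ) = m₀ + m₁ := by rw [hm₀, hm₁]; exact_mod_cast hsumN
  have hm₀0 : 0 ≤ m₀ := Nat.cast_nonneg _
  have hm₁0 : 0 ≤ m₁ := Nat.cast_nonneg _
  have hm0 : 0 < (𝓕.card : ℝ) := by exact_mod_cast hne.card_pos
  have hεm₀ : ε * m₀ ≤ 1 / 10 ^ 7 * m₀ := mul_le_mul_of_nonneg_right hεc' hm₀0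
  have hεm₁ : ε * m₁ ≤ 1 / 10 ^ 7 * m₁ := mul_le_mul_of_nonneg_right hεc' hm₁0
  rw [hsum] at hmin hexc
  have hεsum : ε * (m₀ + m₁) = ε * m₀ + ε * m₁ := by ring
  rw [hεsum] at hmin hexc
  rcases le_total m₁ m₀ with hle | hle
  · /- the lower section is the large one -/
    rw [min_eq_right hle] at hmin hsec
    have h4 : 4 * m₁ ≤ m₀ := by linarith
    have hE := entropyGain_ge_of_four_mul_le hm₁0 h4
    have hexc' : excess X' (lowerSection a 𝓕) ≤ ε * (lowerSection a 𝓕).card := by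
      show excess X' (lowerSection a 𝓕) ≤ ε * m₀
      linarith
    have hne' : (lowerSection a 𝓕).Nonempty := by
      rw [← card_pos, ← Nat.cast_pos (α := ℝ)]
      show 0 < m₀
      linarith
    obtain ⟨B', hB', C', hC', hfar, hdense⟩ := ih X' hX'sub (lowerSection a 𝓕) hlow hne' hexc'
    have hS'a : ∀ S ∈ cubeIn X' B' C', a ∉ S :=
      notMem_of_subset haX' fun S hS => (mem_cubeIn.1 hS).1
    refine ⟨insert a B', ?_, C', hC'.trans (subset_insert a B'), ?_, ?_⟩
    · rw [hXa]; exact insert_subset_insert a hB'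
    · have hcube : cubeIn X (insert a B') C' = cubeIn X' B' C' := by
        rw [hXa]; exact cubeIn_insert_left haX' hB' hC'
      rw [hcube]
      -- `|𝓕 ∖ S'| = m₁ + |𝓕₀ ∖ S'|`
      have hc1 := card_sdiff_add_card_inter 𝓕 (cubeIn X' B' C')
      have hc2 := card_sdiff_add_card_inter (lowerSection a 𝓕) (cubeIn X' B' C')
      rw [inter_eq_lowerSection_inter hS'a, hsumN] at hc1
      have hcnt : ((𝓕 \ cubeIn X' B' C').card : ℝ) =
          m₁ + ((lowerSection a 𝓕 \ cubeIn X' B' C').card : ℝ) := by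
        rw [hm₁]
        exact_mod_cast (show (𝓕 \ cubeIn X' B' C').card =
          (upperSection a 𝓕).card + (lowerSection a 𝓕 \ cubeIn X' B' C').card by omega)
      rw [hcnt]
      linarith
    · have hcube : cubeIn X (insert a B') C' = cubeIn X' B' C' := by
        rw [hXa]; exact cubeIn_insert_left haX' hB' hC'
      rw [hcube, inter_eq_lowerSection_inter hS'a]
      exact hdense
  · /- the upper section is the large one -/
    rw [min_eq_left hle] at hmin hsec
    have h4 : 4 * m₀ ≤ m₁ := by linarith
    have hE := entropyGain_ge_of_four_mul_le hm₀0 h4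
    rw [entropyGain_comm] at hE
    have hexc' : excess X' (upperSection a 𝓕) ≤ ε * (upperSection a 𝓕).card := by
      show excess X' (upperSection a 𝓕) ≤ ε * m₁
      linarith
    have hne' : (upperSection a 𝓕).Nonempty := by
      rw [← card_pos, ← Nat.cast_pos (α := ℝ)]
      show 0 < m₁
      linarith
    obtain ⟨B', hB', C', hC', hfar, hdense⟩ := ih X' hX'sub (upperSection a 𝓕) hupp hne' hexc'
    have hS'a : ∀ S ∈ cubeIn X' B' C', a ∉ S :=
      notMem_of_subset haX' fun S hS => (mem_cubeIn.1 hS).1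
    refine ⟨insert a B', ?_, insert a C', insert_subset_insert a hC', ?_, ?_⟩
    · rw [hXa]; exact insert_subset_insert a hB'
    · have hcube : cubeIn X (insert a B') (insert a C') = (cubeIn X' B' C').image (insert a) := by
        rw [hXa]; exact cubeIn_insert_right haX' hB' hC'
      rw [hcube]
      -- `|𝓕 ∖ S| = m₀ + |𝓕₁ ∖ S'|`
      have hc1 := card_sdiff_add_card_inter 𝓕 ((cubeIn X' B' C').image (insert a))
      have hc2 := card_sdiff_add_card_inter (upperSection a 𝓕) (cubeIn X' B' C')
      rw [card_inter_image_insert hS'a, hsumN] at hc1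
      have hcnt : ((𝓕 \ (cubeIn X' B' C').image (insert a)).card : ℝ) =
          m₀ + ((upperSection a 𝓕 \ cubeIn X' B' C').card : ℝ) := by
        rw [hm₀]
        exact_mod_cast (show (𝓕 \ (cubeIn X' B' C').image (insert a)).card =
          (lowerSection a 𝓕).card + (upperSection a 𝓕 \ cubeIn X' B' C').card by omega)
      rw [hcnt]
      linarith
    · have hcube : cubeIn X (insert a B') (insert a C') = (cubeIn X' B' C').image (insert a) := by
        rw [hXa]; exact cubeIn_insert_right haX' hB' hC'
      rw [hcube, card_inter_image_insert hS'a, card_image_insert hS'a]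
      exact hdense

/-! ### §7 The counting bound of Theorems 8–9 -/

/-- `(T Δ {i}) ∩ B = T ∩ B` for `i ∉ B` (moving a free coordinate keeps the pattern).
[cite: Ellis2011, §2 (proof of Thm 8, p0008)] -/
theorem symmDiff_singleton_inter_of_notMem {T B : Finset α} {i : α} (hi : i ∉ B) :
    (T ∆ ({i} : Finset α)) ∩ B = T ∩ B := by
  ext x
  simp only [mem_inter, mem_symmDiff, mem_singleton]
  constructor
  · rintro ⟨(⟨hx, -⟩ | ⟨rfl, -⟩), hxB⟩
    · exact ⟨hx, hxB⟩
    · exact absurd hxB hi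
  · rintro ⟨hx, hxB⟩
    exact ⟨Or.inl ⟨hx, fun h => hi (h ▸ hxB)⟩, hxB⟩

/-- `(T Δ {i}) ∩ B = (T ∩ B) Δ {i}` for `i ∈ B` (flipping a fixed coordinate breaks the pattern).
[cite: Ellis2011, §2 (proof of Thm 8, p0008: "every point of D is adjacent to at most one point of C")] -/
theorem symmDiff_singleton_inter_of_mem {T B : Finset α} {i : α} (hi : i ∈ B) :
    (T ∆ ({i} : Finset α)) ∩ B = (T ∩ B) ∆ {i} := by
  ext x
  simp only [mem_inter, mem_symmDiff, mem_singleton]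
  by_cases hxi : x = i
  · subst hxi; simp [hi]
  · simp [hxi]

/-- Moving a free coordinate stays inside the subcube. [cite: Ellis2011, §2 (proof of Thm 8, p0008)] -/
theorem symmDiff_singleton_mem_cubeIn {X B C U : Finset α} {i : α} (hU : U ∈ cubeIn X B C)
    (hiX : i ∈ X) (hiB : i ∉ B) : U ∆ {i} ∈ cubeIn X B C := by
  rw [mem_cubeIn] at hU ⊢
  exact ⟨symmDiff_singleton_subset hU.1 hiX, by rw [symmDiff_singleton_inter_of_notMem hiB, hU.2]⟩

/-- **The counting bound (tightbound)** [Ellis2011, proof of Theorem 8]: for a subcube `S` of `P(X)`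
with `N = |B|` fixed coordinates, `M = S ∖ 𝓕`, `D = 𝓕 ∖ S`: "the number of edges in `∂A` between
points of `A ∩ C` and points of `{0,1}ⁿ ∖ C` is at least `N(2^{n−N} − |B|) − |D|`" (each point of `D`
is adjacent to at most one point of `C`); "the number of edges in `∂A` between points of `C` is at least"
`|∂_C M|`; and the boundary edges at `D` not going to `C` number at least `|∂D| − |D|`. In additive
form: `N|S| + |∂_{X∖B} M| + |∂_X D| ≤ |∂_X 𝓕| + 2|D| + N|M|`.
[cite: Ellis2011, §2 (proof of Thm 8, display (tightbound), p0008)] -/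
theorem counting_bound {X B C : Finset α} (hB : B ⊆ X) {𝓕 : Finset (Finset α)}
    (h𝓕 : ∀ S ∈ 𝓕, S ⊆ X) :
    B.card * (cubeIn X B C).card + edgeBoundaryIn (X \ B) (cubeIn X B C \ 𝓕) +
        edgeBoundaryIn X (𝓕 \ cubeIn X B C) ≤
      edgeBoundaryIn X 𝓕 + 2 * (𝓕 \ cubeIn X B C).card + B.card * (cubeIn X B C \ 𝓕).card := by
  classical
  set 𝓢 := cubeIn X B C with h𝓢
  set 𝓜 := 𝓢 \ 𝓕 with h𝓜
  set 𝓓 := 𝓕 \ 𝓢 with h𝓓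
  have mem𝓢 : ∀ {U}, U ∈ 𝓢 ↔ U ⊆ X ∧ U ∩ B = C := fun {U} => by rw [h𝓢, mem_cubeIn]
  -- the boundary-pair set of `𝓕`
  set P := (𝓕 ×ˢ X).filter (fun p : Finset α × α => p.1 ∆ {p.2} ∉ 𝓕) with hP
  have hPcard : P.card = edgeBoundaryIn X 𝓕 := rfl
  -- (I) pairs from `𝓕 ∩ S` across a fixed coordinate
  set P₁ := ((𝓕 ∩ 𝓢) ×ˢ B).filter (fun p : Finset α × α => p.1 ∆ {p.2} ∉ 𝓕) with hP₁
  set Q₁ := ((𝓕 ∩ 𝓢) ×ˢ B).filter (fun p : Finset α × α => ¬ (p.1 ∆ {p.2} ∉ 𝓕)) with hQ₁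
  have hPQ : P₁.card + Q₁.card = (𝓕 ∩ 𝓢).card * B.card := by
    rw [hP₁, hQ₁, card_filter_add_card_filter_not, card_product]
  have hQ₁le : Q₁.card ≤ 𝓓.card := by
    refine card_le_card_of_injOn (fun p => p.1 ∆ {p.2}) ?_ ?_
    · intro p hp
      rw [hQ₁, mem_coe, mem_filter, mem_product, mem_inter, not_not] at hp
      obtain ⟨⟨⟨-, hS⟩, hi⟩, hin⟩ := hp
      rw [mem_coe, h𝓓, mem_sdiff]
      refine ⟨hin, fun h => ?_⟩
      have h1 := (mem𝓢.1 h).2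
      rw [symmDiff_singleton_inter_of_mem hi, (mem𝓢.1 hS).2] at h1
      have hmem : p.2 ∈ C ∆ {p.2} ↔ p.2 ∉ C := by
        rw [mem_symmDiff, mem_singleton]; tauto
      rw [h1] at hmem
      exact iff_not_self hmem
    · intro p hp q hq hpq
      rw [hQ₁, mem_coe, mem_filter, mem_product, mem_inter] at hp hq
      have hpS := (mem𝓢.1 hp.1.1.2).2
      have hqS := (mem𝓢.1 hq.1.1.2).2
      have h' : p.1 ∆ {p.2} = q.1 ∆ {q.2} := hpq
      have hB' := congrArg (· ∩ B) h'
      simp only [symmDiff_singleton_inter_of_mem hp.1.2, symmDiff_singleton_inter_of_mem hq.1.2,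
        hpS, hqS] at hB'
      have h2 : p.2 = q.2 := by
        have := symmDiff_right_inj.1 hB'
        exact singleton_inj.1 this
      refine Prod.ext ?_ h2
      rw [h2] at h'
      exact symmDiff_left_inj.1 h'
  -- (II) pairs across a moving coordinate inside the cube, seen from `M`
  set P₂ := ((𝓜 ×ˢ (X \ B)).filter (fun p : Finset α × α => p.1 ∆ {p.2} ∉ 𝓜)).image
    (fun p : Finset α × α => (p.1 ∆ {p.2}, p.2)) with hP₂
  have hP₂card : P₂.card = edgeBoundaryIn (X \ B) 𝓜 := by
    rw [hP₂]
    refine card_image_of_injective _ fun p q hpq => ?_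
    simp only [Prod.mk.injEq] at hpq
    obtain ⟨h1, h2⟩ := hpq
    refine Prod.ext ?_ h2
    rw [h2] at h1
    exact symmDiff_left_inj.1 h1
  -- (III) boundary pairs of `D` not landing in the cube, and those landing in the cube
  set P₃ := (𝓓 ×ˢ X).filter (fun p : Finset α × α => p.1 ∆ {p.2} ∉ 𝓓 ∧ p.1 ∆ {p.2} ∉ 𝓢) with hP₃
  set R₃ := (𝓓 ×ˢ X).filter (fun p : Finset α × α => p.1 ∆ {p.2} ∈ 𝓢) with hR₃
  have hD : edgeBoundaryIn X 𝓓 ≤ P₃.card + R₃.card := by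
    unfold edgeBoundaryIn
    refine le_trans (card_le_card ?_) (card_union_le _ _)
    intro p hp
    rw [mem_filter] at hp
    rw [mem_union, hP₃, hR₃, mem_filter, mem_filter]
    by_cases h : p.1 ∆ {p.2} ∈ 𝓢
    · exact Or.inr ⟨hp.1, h⟩
    · exact Or.inl ⟨hp.1, hp.2, h⟩
  have hR₃le : R₃.card ≤ 𝓓.card := by
    refine card_le_card_of_injOn (fun p => p.1) ?_ ?_
    · intro p hp
      rw [hR₃, mem_coe, mem_filter, mem_product] at hp
      exact hp.1.1
    · intro p hp q hq hpq
      rw [hR₃, mem_coe, mem_filter, mem_product] at hp hq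
      have h1 : p.1 = q.1 := hpq
      -- `T := p.1 ∉ S`, `T ⊆ X`; both `T Δ {p.2}` and `T Δ {q.2}` lie in `S`
      have hT𝓓 := hp.1.1
      rw [h𝓓, mem_sdiff] at hT𝓓
      have hTX : p.1 ⊆ X := h𝓕 _ hT𝓓.1
      have hTS : p.1 ∩ B ≠ C := fun h => hT𝓓.2 (mem𝓢.2 ⟨hTX, h⟩)
      have key : ∀ i, p.1 ∆ {i} ∈ 𝓢 → i ∈ B ∧ (p.1 ∩ B) ∆ {i} = C := by
        intro i hi
        have hpat := (mem𝓢.1 hi).2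
        by_cases hiB : i ∈ B
        · rw [symmDiff_singleton_inter_of_mem hiB] at hpat
          exact ⟨hiB, hpat⟩
        · rw [symmDiff_singleton_inter_of_notMem hiB] at hpat
          exact absurd hpat hTS
      obtain ⟨-, hpC⟩ := key p.2 hp.2
      have hq2 := hq.2
      rw [← h1] at hq2
      obtain ⟨-, hqC⟩ := key q.2 hq2
      rw [← hqC] at hpC
      exact Prod.ext h1 (singleton_inj.1 (symmDiff_right_inj.1 hpC))
  -- the three classes lie in `P` and are pairwise disjoint
  have h1P : P₁ ⊆ P := by
    intro p hp
    rw [hP₁, mem_filter, mem_product, mem_inter] at hp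
    rw [hP, mem_filter, mem_product]
    exact ⟨⟨hp.1.1.1, hB hp.1.2⟩, hp.2⟩
  have h2P : P₂ ⊆ P := by
    intro q hq
    rw [hP₂, mem_image] at hq
    obtain ⟨p, hp, rfl⟩ := hq
    rw [mem_filter, mem_product] at hp
    obtain ⟨⟨hU, hi⟩, hout⟩ := hp
    rw [mem_sdiff] at hi
    obtain ⟨hiX, hiB⟩ := hi
    rw [h𝓜, mem_sdiff] at hU hout
    have hUi : p.1 ∆ {p.2} ∈ 𝓢 := symmDiff_singleton_mem_cubeIn hU.1 hiX hiB
    rw [hP, mem_filter, mem_product]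
    refine ⟨⟨?_, hiX⟩, ?_⟩
    · by_contra h
      exact hout ⟨hUi, h⟩
    · show (p.1 ∆ {p.2}) ∆ {p.2} ∉ 𝓕
      rw [symmDiff_symmDiff_cancel_right]
      exact hU.2
  have h3P : P₃ ⊆ P := by
    intro p hp
    rw [hP₃, mem_filter, mem_product] at hp
    obtain ⟨⟨hT, hi⟩, hnD, hnS⟩ := hp
    rw [h𝓓, mem_sdiff] at hT hnD
    rw [hP, mem_filter, mem_product]
    refine ⟨⟨hT.1, hi⟩, fun h => hnD ⟨h, hnS⟩⟩
  have c1 : ∀ p ∈ P₁, p.1 ∈ 𝓢 ∧ p.2 ∈ B := fun p hp => by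
    rw [hP₁, mem_filter, mem_product, mem_inter] at hp
    exact ⟨hp.1.1.2, hp.1.2⟩
  have c2 : ∀ p ∈ P₂, p.1 ∈ 𝓢 ∧ p.2 ∉ B := fun q hq => by
    rw [hP₂, mem_image] at hq
    obtain ⟨p, hp, rfl⟩ := hq
    rw [mem_filter, mem_product] at hp
    obtain ⟨⟨hU, hi⟩, -⟩ := hp
    rw [mem_sdiff] at hi
    obtain ⟨hiX, hiB⟩ := hi
    rw [h𝓜, mem_sdiff] at hU
    exact ⟨symmDiff_singleton_mem_cubeIn hU.1 hiX hiB, hiB⟩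
  have c3 : ∀ p ∈ P₃, p.1 ∉ 𝓢 := fun p hp => by
    rw [hP₃, mem_filter, mem_product] at hp
    have := hp.1.1
    rw [h𝓓, mem_sdiff] at this
    exact this.2
  have d12 : Disjoint P₁ P₂ := disjoint_left.2 fun p hp hp' => (c2 p hp').2 (c1 p hp).2
  have d13 : Disjoint P₁ P₃ := disjoint_left.2 fun p hp hp' => (c3 p hp') (c1 p hp).1
  have d23 : Disjoint P₂ P₃ := disjoint_left.2 fun p hp hp' => (c3 p hp') (c2 p hp).1
  have hsub : P₁ ∪ P₂ ∪ P₃ ⊆ P := union_subset (union_subset h1P h2P) h3P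
  have hcard : (P₁ ∪ P₂ ∪ P₃).card = P₁.card + P₂.card + P₃.card := by
    rw [card_union_of_disjoint (disjoint_union_left.2 ⟨d13, d23⟩), card_union_of_disjoint d12]
  have hle := card_le_card hsub
  rw [hcard, hPcard] at hle
  -- sizes inside the cube
  have h𝓢split : (𝓕 ∩ 𝓢).card + 𝓜.card = 𝓢.card := by
    rw [h𝓜, inter_comm, add_comm]
    exact card_sdiff_add_card_inter 𝓢 𝓕
  -- assemble
  have hmul : B.card * 𝓢.card = (P₁.card + Q₁.card) + B.card * 𝓜.card := by
    rw [hPQ, ← h𝓢split]; ring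
  rw [hmul, ← hP₂card]
  omega

/-- **The excess of a family of size `2^d` in terms of its distance to a `d`-dimensional subcube**
[Ellis2011, proof of Theorem 9]: with `b = |𝓕 ∖ S| = |S ∖ 𝓕|` (`|S| = |𝓕| = 2^d`),
`|∂𝓕| ≥ |𝓕| log₂(2ⁿ/|𝓕|) + 2b log₂(2ⁿ/b) − 2b log₂(2ⁿ/|𝓕|) − 2b`, i.e. `exc(𝓕) ≥ 2b(d − 1 − log₂ b)`
(`= |A| δ log₂(1/δ)` with `δ = 2b/2^d`). From the counting bound and the edge-isoperimetric
inequality (log form) for `M` inside the cube and for `D`.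
[cite: Ellis2011, §2 (proof of Thm 9, p0009, the display ending "= |A| log₂(2ⁿ/|A|) + |A|δ log₂(1/δ)")] -/
theorem two_mul_card_sdiff_mul_le_excess {X B C : Finset α} (hB : B ⊆ X) (hC : C ⊆ B)
    {𝓕 : Finset (Finset α)} (h𝓕 : ∀ S ∈ 𝓕, S ⊆ X) {d : ℕ} (hcard : 𝓕.card = 2 ^ d)
    (hBd : B.card + d = X.card) :
    2 * ((𝓕 \ cubeIn X B C).card : ℝ) *
        ((d : ℝ) - 1 - Real.logb 2 ((𝓕 \ cubeIn X B C).card : ℝ)) ≤ excess X 𝓕 := by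
  classical
  set 𝓢 := cubeIn X B C with h𝓢
  set 𝓜 := 𝓢 \ 𝓕 with h𝓜
  set 𝓓 := 𝓕 \ 𝓢 with h𝓓
  have hXB : (X \ B).card = d := by
    rw [card_sdiff_of_subset hB]; omega
  have h𝓢card : 𝓢.card = 2 ^ d := by
    rw [h𝓢, card_cubeIn hB hC, ← hXB, card_sdiff_of_subset hB]
  -- `|M| = |D| =: b`
  have h1 := card_sdiff_add_card_inter 𝓢 𝓕
  have h2 := card_sdiff_add_card_inter 𝓕 𝓢
  rw [inter_comm] at h1
  have hMD : 𝓜.card = 𝓓.card := by rw [h𝓜, h𝓓]; omega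
  -- the counting bound
  have hcnt := counting_bound (C := C) hB h𝓕
  rw [← h𝓢, ← h𝓜, ← h𝓓] at hcnt
  -- Harper for `M` (translated into `P(X ∖ B)`) and for `D`
  have h𝓜pat : ∀ U ∈ 𝓜, U ∩ B = C := fun U hU => by
    rw [h𝓜, mem_sdiff] at hU; exact (mem_cubeIn.1 hU.1).2
  have h𝓜X : ∀ U ∈ 𝓜.image (fun U => U \ B), U ⊆ X \ B := fun V hV => by
    rw [mem_image] at hV
    obtain ⟨U, hU, rfl⟩ := hV
    rw [h𝓜, mem_sdiff] at hU
    exact sdiff_subset_sdiff (mem_cubeIn.1 hU.1).1 subset_rfl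
  have hHM := card_mul_sub_logb_le_edgeBoundaryIn (X \ B) (𝓜.image fun U => U \ B) h𝓜X
  rw [edgeBoundaryIn_image_sdiff disjoint_sdiff_self_left h𝓜pat, card_image_sdiff_of_inter_eq h𝓜pat,
    hXB, hMD] at hHM
  have h𝓓X : ∀ S ∈ 𝓓, S ⊆ X := fun S hS => by
    rw [h𝓓, mem_sdiff] at hS; exact h𝓕 S hS.1
  have hHD := card_mul_sub_logb_le_edgeBoundaryIn X 𝓓 h𝓓X
  -- real-ify the counting bound
  have hcntR : (B.card : ℝ) * 2 ^ d + edgeBoundaryIn (X \ B) 𝓜 + edgeBoundaryIn X 𝓓 ≤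
      edgeBoundaryIn X 𝓕 + 2 * 𝓓.card + B.card * 𝓓.card := by
    rw [h𝓢card, hMD] at hcnt
    exact_mod_cast hcnt
  have hBd' : (B.card : ℝ) = X.card - d := by
    rw [← hBd]; push_cast; ring
  unfold excess
  rw [hcard]
  push_cast
  rw [Real.logb_pow, Real.logb_self_eq_one one_lt_two]
  rw [hBd'] at hcntR
  nlinarith [hHM, hHD, hcntR]

/-! ### §8 `x ↦ x log₂(1/x)` on `[0, 1/e]` -/

/-- `x ↦ −x ln x` is monotone on `[0, 1/e]` ("`h'(x) = −(1/ln 2)(1 + ln x)` and `h` is therefore strictly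
increasing between `0` and `1/e`"). (The same calculus fact is proved summit-side as
`Summit.MatrixMultiplication.OmegaCensus.LaserProgram.monotoneOn_negMulLog`, which a Literature file may
not import.) [cite: Ellis2011, §2 (proof of Thm 9, p0009)] -/
theorem monotoneOn_negMulLog_Icc : MonotoneOn Real.negMulLog (Set.Icc 0 (Real.exp (-1))) := by
  refine monotoneOn_of_deriv_nonneg (convex_Icc _ _) Real.continuous_negMulLog.continuousOn ?_ ?_
  · intro x hx
    rw [interior_Icc] at hx
    exact (Real.differentiableAt_negMulLog_iff.2 hx.1.ne').differentiableWithinAt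
  · intro x hx
    rw [interior_Icc] at hx
    rw [Real.deriv_negMulLog hx.1.ne']
    have h : Real.log x < -1 := by
      have := Real.log_lt_log hx.1 hx.2
      rwa [Real.log_exp] at this
    linarith

omit [DecidableEq α] in
/-- `x log₂(1/x) = (−x ln x)/ln 2`. [cite: Ellis2011, §2 (proof of Thm 9, p0009, the function h)] -/
theorem mul_logb_one_div_eq (x : ℝ) : x * Real.logb 2 (1 / x) = Real.negMulLog x / Real.log 2 := by
  rw [one_div, Real.logb_inv, Real.negMulLog, Real.logb]
  ring

omit [DecidableEq α] in
/-- **`h(x) = x log₂(1/x)` is monotone on `[0, 1/e]`.** [cite: Ellis2011, §2 (proof of Thm 9, p0009)] -/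
theorem mul_logb_one_div_mono {x y : ℝ} (hx : 0 ≤ x) (hxy : x ≤ y) (hy : y ≤ Real.exp (-1)) :
    x * Real.logb 2 (1 / x) ≤ y * Real.logb 2 (1 / y) := by
  rw [mul_logb_one_div_eq, mul_logb_one_div_eq]
  exact div_le_div_of_nonneg_right
    (monotoneOn_negMulLog_Icc ⟨hx, hxy.trans hy⟩ ⟨hx.trans hxy, hy⟩ hxy) (Real.log_pos one_lt_two).le

omit [DecidableEq α] in
/-- A crude bound `x log₂(1/x) ≤ 3√x` (`ln(1/x) = 2 ln(1/√x) ≤ 2/√x`), used to compare the two regimes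
of Corollary 10 ("`max{δ log₂(1/δ), c}`"). [cite: Ellis2011, §2 (Corollary 10, p0009)] -/
theorem mul_logb_one_div_le_sqrt {x : ℝ} (hx : 0 ≤ x) : x * Real.logb 2 (1 / x) ≤ 3 * Real.sqrt x := by
  rcases hx.eq_or_lt with h | hx0
  · rw [← h]; simp
  have hs : 0 < Real.sqrt x := Real.sqrt_pos.2 hx0
  have hlog2 : 0 < Real.log 2 := Real.log_pos one_lt_two
  have hl2 : 2 / 3 ≤ Real.log 2 := by linarith [Real.log_two_gt_d9]
  have h1 : Real.log (1 / x) = 2 * Real.log (1 / Real.sqrt x) := by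
    rw [one_div, one_div, Real.log_inv, Real.log_inv, Real.log_sqrt hx]; ring
  have h2 : Real.log (1 / Real.sqrt x) ≤ 1 / Real.sqrt x - 1 :=
    Real.log_le_sub_one_of_pos (by positivity)
  have hxs : x * (1 / Real.sqrt x) = Real.sqrt x := by rw [mul_one_div, Real.div_sqrt]
  have h3 : x * (2 * Real.log (1 / Real.sqrt x)) ≤ 2 * Real.sqrt x := by
    have := mul_le_mul_of_nonneg_left h2 hx
    have hexp : x * (1 / Real.sqrt x - 1) = Real.sqrt x - x := by rw [mul_sub, hxs, mul_one]
    nlinarith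
  rw [Real.logb, h1]
  calc x * (2 * Real.log (1 / Real.sqrt x) / Real.log 2)
      = (x * (2 * Real.log (1 / Real.sqrt x))) / Real.log 2 := by ring
    _ ≤ (2 * Real.sqrt x) / Real.log 2 := div_le_div_of_nonneg_right h3 hlog2.le
    _ ≤ 3 * Real.sqrt x := by rw [div_le_iff₀ hlog2]; nlinarith

/-- **Theorem 7 as printed (families of arbitrary size)** [Ellis2011]: "There exists an absolute constant
`c > 0` such that if `A ⊂ {0,1}ⁿ` with `|∂A| ≤ |A| log₂(2ⁿ/|A|) + ε|A|` for some `ε ≤ c`, then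
`|A Δ C|/|A| < 3ε` for some subcube `C`" — here on any ground set `X`, with `c = c₆ = 10⁻⁷` and `0 < ε`
(from `rough_stability`: `|A ∖ C| ≤ (2/3)ε|A|` and `|C ∖ A| < ε|C| < ε|A|/(1−ε)`).
[cite: Ellis2011, §2 (Theorem 7, p0007; end of its proof, display (roughbound), p0008)] -/
theorem rough_stability_symmDiff {ε : ℝ} (hε : 0 < ε) (hεc : ε ≤ ellisConst) (X : Finset α)
    (𝓕 : Finset (Finset α)) (h𝓕X : ∀ S ∈ 𝓕, S ⊆ X) (hne : 𝓕.Nonempty)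
    (hexc : excess X 𝓕 ≤ ε * 𝓕.card) :
    ∃ B ⊆ X, ∃ C ⊆ B, ((𝓕 ∆ cubeIn X B C).card : ℝ) < 3 * ε * 𝓕.card := by
  obtain ⟨B, hB, C, hC, hfar, hdense⟩ := rough_stability hε hεc X 𝓕 h𝓕X hne hexc
  refine ⟨B, hB, C, hC, ?_⟩
  have hεc' : ε ≤ 1 / 10 ^ 7 := hεc
  set 𝓢 := cubeIn X B C with h𝓢
  have hsd : 𝓕 ∆ 𝓢 = 𝓕 \ 𝓢 ∪ 𝓢 \ 𝓕 := by
    ext S; simp only [mem_symmDiff, mem_union, mem_sdiff]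
  rw [hsd, card_union_of_disjoint disjoint_sdiff_sdiff, Nat.cast_add]
  have h1 := card_sdiff_add_card_inter 𝓢 𝓕
  rw [inter_comm] at h1
  have h1R : ((𝓢 \ 𝓕).card : ℝ) + ((𝓕 ∩ 𝓢).card : ℝ) = 𝓢.card := by exact_mod_cast h1
  have h2R : ((𝓕 ∩ 𝓢).card : ℝ) ≤ 𝓕.card := by
    exact_mod_cast card_le_card inter_subset_left
  have hu0 : 0 ≤ ε * (𝓢.card : ℝ) := by positivity
  have hεu : ε * (ε * (𝓢.card : ℝ)) ≤ 1 / 10 ^ 7 * (ε * (𝓢.card : ℝ)) :=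
    mul_le_mul_of_nonneg_right hεc' hu0
  have hlt : ε * ((𝓢.card : ℝ) - ε * 𝓢.card) < ε * 𝓕.card :=
    mul_lt_mul_of_pos_left (by linarith) hε
  nlinarith

end General

/-! ### §9 The discharge of `Ellis2011_thm` ([EllisKellerLifshitz2018, Thm 1.4] = [Ellis2011, Cor. 10]) -/

variable {n : ℕ}

/-- On the full ground set `[n]`, `cubeIn` is the tree's `subcube`. [cite: Ellis2011, §1 (p0001)] -/
theorem cubeIn_univ_eq_subcube (B C : Finset (Fin n)) : cubeIn univ B C = subcube B C := by
  unfold cubeIn subcube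
  rw [powerset_univ]

/-- `exc_{[n]}(𝓕) = |∂𝓕| − 2^d (n − d)` for `|𝓕| = 2^d`. [cite: Ellis2011, §2 (Thm 9, p0008: "|A| log₂(2ⁿ/|A|) + ε|A| = 2^t(n − t + ε)")] -/
theorem excess_univ_eq (𝓕 : Finset (Finset (Fin n))) {d : ℕ} (hcard : 𝓕.card = 2 ^ d) :
    excess univ 𝓕 = (edgeBoundary 𝓕 : ℝ) - 2 ^ d * ((n : ℝ) - d) := by
  unfold excess edgeBoundary
  rw [hcard, card_univ, Fintype.card_fin]
  push_cast
  rw [Real.logb_pow, Real.logb_self_eq_one one_lt_two]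
  ring

/-- **Discharge of the named fact `Ellis2011_thm`** = [EllisKellerLifshitz2018, Thm 1.4] =
[Ellis2011, Corollary 10]: "if `A ⊂ {0,1}ⁿ` has size `2^t` … and cannot be made into a subcube by
fewer than `δ|A|` additions and deletions, then `|∂A| ≥ 2^t(n − t + δ log₂(1/δ))`, provided `δ` is less
than an absolute constant" — here `c = (c₆/3)²`. Proof as printed: if the excess is `> c₆|A|` the claim
follows from `δ log₂(1/δ) ≤ 3√δ ≤ c₆`; otherwise Theorem 7 gives a subcube `C` with `|A Δ C|/|A| < 1/e`, of
dimension `t` for size reasons, the counting bound gives `exc ≥ |A| δ* log₂(1/δ*)` for `δ* = |A Δ C|/|A| ≥ δ`,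
and `x ↦ x log₂(1/x)` is increasing on `[0, 1/e]` (Ellis' Remark 3).
[cite: Ellis2011, §2 (Theorem 9 and Corollary 10 with their proofs, p0008–p0009)]
[cite: EllisKellerLifshitz2018, Thm 1.4 (p0004)] -/
theorem Ellis2011_thm_holds : Ellis2011_thm := by
  have hc6 := ellisConst_pos
  have hc6' : ellisConst = 1 / 10 ^ 7 := ellisConst_eq
  refine ⟨(ellisConst / 3) ^ 2, by positivity, ?_⟩
  intro δ hδ0 hδc n d 𝓕 hcard hfar
  classical
  have h𝓕X : ∀ S ∈ 𝓕, S ⊆ (univ : Finset (Fin n)) := fun S _ => subset_univ S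
  have hexc := excess_univ_eq 𝓕 hcard
  have hexc0 : 0 ≤ excess univ 𝓕 := excess_nonneg h𝓕X
  have hT : (0 : ℝ) < 2 ^ d := by positivity
  -- `h(δ) ≤ 3√δ ≤ c₆`
  have hδh : δ * Real.logb 2 (1 / δ) ≤ ellisConst := by
    have h1 := mul_logb_one_div_le_sqrt hδ0
    have h2 : Real.sqrt δ ≤ ellisConst / 3 := by
      rw [← Real.sqrt_sq (show 0 ≤ ellisConst / 3 by linarith)]
      exact Real.sqrt_le_sqrt hδc.le
    linarith
  suffices hmain : (2 : ℝ) ^ d * (δ * Real.logb 2 (1 / δ)) ≤ excess univ 𝓕 by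
    rw [hexc] at hmain; linarith
  by_cases hsmall : excess univ 𝓕 ≤ ellisConst * 𝓕.card
  · have hne : 𝓕.Nonempty := by rw [← card_pos, hcard]; positivity
    obtain ⟨B, hB, C, hC, hfarS, hdense⟩ :=
      rough_stability hc6 le_rfl (univ : Finset (Fin n)) 𝓕 h𝓕X hne hsmall
    rw [hcard] at hsmall
    push_cast at hsmall
    set 𝓢 := cubeIn (univ : Finset (Fin n)) B C with h𝓢
    have hScardN : 𝓢.card = 2 ^ (n - B.card) := by
      rw [h𝓢, card_cubeIn hB hC, card_univ, Fintype.card_fin]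
    have hsplit := card_sdiff_add_card_inter 𝓕 𝓢
    rw [hcard] at hsplit
    have hinter_le : (𝓕 ∩ 𝓢).card ≤ 𝓢.card := card_le_card inter_subset_right
    have hbR : 3 / 2 * ((𝓕 \ 𝓢).card : ℝ) ≤ ellisConst * 2 ^ d := le_trans hfarS hsmall
    have hsplitR : ((𝓕 \ 𝓢).card : ℝ) + ((𝓕 ∩ 𝓢).card : ℝ) = 2 ^ d := by exact_mod_cast hsplit
    have hinterR : ((𝓕 ∩ 𝓢).card : ℝ) ≤ 𝓢.card := by exact_mod_cast hinter_le
    have hSR : (𝓢.card : ℝ) = 2 ^ (n - B.card) := by rw [hScardN]; push_cast; rfl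
    rw [hc6'] at hbR hdense
    rw [hSR] at hinterR hdense
    -- pin the dimension of the cube: `n − |B| = d`
    have hs : n - B.card = d := by
      have hge : ¬ n - B.card < d := by
        intro hlt
        have h2 : (2 : ℝ) ^ (n - B.card) * 2 ≤ 2 ^ d := by
          rw [← pow_succ]; exact pow_le_pow_right₀ (by norm_num) (by omega)
        linarith
      have hle : ¬ d < n - B.card := by
        intro hlt
        have h2 : (2 : ℝ) ^ d * 2 ≤ 2 ^ (n - B.card) := by
          rw [← pow_succ]; exact pow_le_pow_right₀ (by norm_num) (by omega)
        linarith
      omega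
    have hBn : B.card ≤ n := by simpa using card_le_univ B
    have hBcard : B.card = n - d := by omega
    -- the hypothesis for this subcube, of dimension `d`
    have hfar𝓢 := hfar B C hC hBcard
    rw [← cubeIn_univ_eq_subcube, ← h𝓢] at hfar𝓢
    have hScard : 𝓢.card = 2 ^ d := by rw [hScardN, hs]
    have hsplit' := card_sdiff_add_card_inter 𝓢 𝓕
    rw [hScard, inter_comm] at hsplit'
    have hbb : (𝓢 \ 𝓕).card = (𝓕 \ 𝓢).card := by omega
    have hsd : 𝓕 ∆ 𝓢 = 𝓕 \ 𝓢 ∪ 𝓢 \ 𝓕 := by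
      ext S; simp only [mem_symmDiff, mem_union, mem_sdiff]
    have hsymm : (𝓕 ∆ 𝓢).card = 2 * (𝓕 \ 𝓢).card := by
      rw [hsd, card_union_of_disjoint disjoint_sdiff_sdiff, hbb]; ring
    set b : ℝ := ((𝓕 \ 𝓢).card : ℝ) with hb
    have hb0 : 0 ≤ b := Nat.cast_nonneg _
    have hδle : δ ≤ 2 * b / 2 ^ d := by
      rw [le_div_iff₀ hT]
      have : δ * 2 ^ d ≤ ((𝓕 ∆ 𝓢).card : ℝ) := hfar𝓢
      rw [hsymm] at this
      push_cast at this
      linarith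
    have hδ'le : 2 * b / 2 ^ d ≤ Real.exp (-1) := by
      have he : (1 : ℝ) / 3 ≤ Real.exp (-1) := by
        have h3 : Real.exp 1 ≤ 3 := by linarith [Real.exp_one_lt_d9]
        rw [Real.exp_neg, one_div]
        exact inv_anti₀ (Real.exp_pos 1) h3
      rw [div_le_iff₀ hT]
      have := mul_le_mul_of_nonneg_right he hT.le
      linarith
    -- the counting bound: `exc ≥ 2b(d − 1 − log₂ b) = 2^d · h(2b/2^d)`
    have hBd : B.card + d = (univ : Finset (Fin n)).card := by
      rw [card_univ, Fintype.card_fin]; omega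
    have hcount := two_mul_card_sdiff_mul_le_excess hB hC h𝓕X hcard hBd
    rw [← h𝓢] at hcount
    have hkey : (2 : ℝ) ^ d * ((2 * b / 2 ^ d) * Real.logb 2 (1 / (2 * b / 2 ^ d))) ≤
        excess univ 𝓕 := by
      rcases hb0.eq_or_lt with hb00 | hbpos
      · have hz : 2 * b / 2 ^ d = 0 := by rw [← hb00, mul_zero, zero_div]
        rw [hz, zero_mul, mul_zero]
        exact hexc0
      · have heq : (2 : ℝ) ^ d * ((2 * b / 2 ^ d) * Real.logb 2 (1 / (2 * b / 2 ^ d))) =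
            2 * b * ((d : ℝ) - 1 - Real.logb 2 b) := by
          rw [one_div, Real.logb_inv, Real.logb_div (mul_pos two_pos hbpos).ne' hT.ne',
            Real.logb_mul (by norm_num) hbpos.ne', Real.logb_pow, Real.logb_self_eq_one one_lt_two]
          field_simp
          ring
        rw [heq]
        exact hcount
    calc (2 : ℝ) ^ d * (δ * Real.logb 2 (1 / δ))
        ≤ 2 ^ d * ((2 * b / 2 ^ d) * Real.logb 2 (1 / (2 * b / 2 ^ d))) :=
          mul_le_mul_of_nonneg_left (mul_logb_one_div_mono hδ0 hδle hδ'le) hT.le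
      _ ≤ excess univ 𝓕 := hkey
  · rw [not_le, hcard] at hsmall
    push_cast at hsmall
    have := mul_le_mul_of_nonneg_left hδh hT.le
    linarith

/-- **Theorem 7 on `[n]`, in the printed hypothesis form**: there is an absolute constant `c > 0` (here
`c₆`) such that every nonempty `𝓕 ⊆ P([n])` with `|∂𝓕| ≤ |𝓕| log₂(2ⁿ/|𝓕|) + ε|𝓕|`, `0 < ε ≤ c`, is
`3ε|𝓕|`-close to a subcube. [cite: Ellis2011, §2 (Theorem 7, p0007)] -/
theorem ellis_rough_stability : ∃ c : ℝ, 0 < c ∧ ∀ (ε : ℝ), 0 < ε → ε ≤ c →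
    ∀ (n : ℕ) (𝓕 : Finset (Finset (Fin n))), 𝓕.Nonempty →
      (edgeBoundary 𝓕 : ℝ) ≤ 𝓕.card * ((n : ℝ) - Real.logb 2 𝓕.card) + ε * 𝓕.card →
      ∃ B C : Finset (Fin n), C ⊆ B ∧ ((𝓕 ∆ subcube B C).card : ℝ) < 3 * ε * 𝓕.card := by
  refine ⟨ellisConst, ellisConst_pos, ?_⟩
  intro ε hε hεc n 𝓕 hne hbd
  have hexc : excess univ 𝓕 ≤ ε * 𝓕.card := by
    unfold excess edgeBoundary at *
    rw [card_univ, Fintype.card_fin]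
    linarith
  obtain ⟨B, -, C, hC, h⟩ :=
    rough_stability_symmDiff hε hεc univ 𝓕 (fun S _ => subset_univ S) hne hexc
  exact ⟨B, C, hC, by rwa [cubeIn_univ_eq_subcube] at h⟩

/-- **Theorem 9 (exact stability for sizes `2^d`), contrapositive form** [Ellis2011]: with the absolute
constant `c` of `Ellis2011_thm_holds`, for `0 < δ < c`: if `|𝓕| = 2^d` and
`|∂𝓕| < 2^d(n − d) + 2^d δ log₂(1/δ)`, then some `d`-dimensional subcube `𝓒` has `|𝓕 Δ 𝓒| < δ 2^d`
("then there exists a codimension-`N` subcube `C` such that `|A Δ C| ≤ δ₁(ε)|A|`, `δ₁ log₂(1/δ₁) = ε`").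
[cite: Ellis2011, §2 (Theorem 9, p0008–p0009)] -/
theorem exists_subcube_of_edgeBoundary_lt : ∃ c : ℝ, 0 < c ∧ ∀ (δ : ℝ), 0 ≤ δ → δ < c →
    ∀ (n d : ℕ) (𝓕 : Finset (Finset (Fin n))), 𝓕.card = 2 ^ d →
      (edgeBoundary 𝓕 : ℝ) < (2 : ℝ) ^ d * ((n : ℝ) - d) + 2 ^ d * δ * Real.logb 2 (1 / δ) →
      ∃ B C : Finset (Fin n), C ⊆ B ∧ B.card = n - d ∧ ((𝓕 ∆ subcube B C).card : ℝ) < δ * 2 ^ d := by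
  obtain ⟨c, hc, h⟩ := Ellis2011_thm_holds
  refine ⟨c, hc, ?_⟩
  intro δ hδ0 hδc n d 𝓕 hcard hlt
  by_contra hno
  push Not at hno
  have := h δ hδ0 hδc n d 𝓕 hcard (fun B C hCB hB => hno B C hCB hB)
  linarith

end CubeEdgeIsoperimetry

end Literature.Combinatorics.SetFamily
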